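import Literature.Probability.Percolation.RhombicTilingPlanarity
import Literature.Topology.PlaneTopology.AnnulusArcs
import HarnessLib

/-!
# Planarity of rhombic tilings, II: sides, the tile across a side, even side-loops, and
corner consistency

Topic `Literature/Probability/Percolation`. Sequel to `RhombicTilingPlanarity` (part I: convex
geometry of one rhombus and the disjointness of interiors). Let `emb : RhombicEmbedding G F` be
isoradial (`IsIsoradial`) and satisfy the tiling condition (`IsRhombicTiling`), with bounded
angles (`HasBoundedAngles ε`, `0 < ε`) and no vertex without neighbour. Grimmett–Manolescu
(*Bond percolation on isoradial graphs*, PTRF 159 (2014) = arXiv:1204.0505, §4.1) use throughout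
that the diamond graph `G^◇` is then a genuine planar rhombic *tiling*: the rhombi meet full side
to full side, the corner graph is bipartite with the vertices of `G` on one side and the face
centres (vertices of `G*`) on the other, so that in particular **no vertex position of `G` is a
face-centre position** ("corner consistency", the hypothesis `hcons` of
`IsoradialDuality.gm_theta_critical_eq_zero_of_dual_boxCrossing`, file `IsoradialDualCrossings`).
In the tree these facts must be *derived* from the three clauses of `IsRhombicTiling`, and they
do **not** follow without a
global hypothesis (part I, module docstring: relabel a half-plane). This file proves them from
`G.Preconnected` under the side condition that the tiling has **no T-junctions** (no corner of a
rhombus lies in the open side of another rhombus) — a condition that is itself a consequence of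
`G.Preconnected` (fault lines of a tiling by unit rhombi are complete straight lines and
disconnect `G`; part III, `RhombicTilingFaultLines`).

Contents.
* §1 (`RhombicPlanarity`) Plane geometry of a parallelogram `A, P, B = P + Q - A, Q` with unit
  sides: the cross product `cross`, Cramer coordinates, `mem_convexHull_quad_iff` (points are
  `A + s (P - A) + t (Q - A)`, `s, t ∈ [0, 1]`), inner points are interior
  (`mem_interior_quad_of_coords`), boundary points lie on one of the four closed sides
  (`mem_sides_of_not_mem_interior`), the parallelogram lies in the closed half-plane of each
  side (`cross_mul_cross_nonneg_of_mem`), no side point is interior, and the **half-disc lemma**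
  `exists_ball_inter_halfPlane_subset_quad` (near a point of an open side the parallelogram is
  the half-disc).
* §2 The tiling near a point: `RhombicEmbedding.dartFace` (the four sides of the rhombus of
  `d₀` are `[z d.fst, c (dartFace d b)]`, `d ∈ {d₀, d₀.symm}`), finitely many rhombi meet a
  bounded set (`finite_setOf_rhombus_meets` — local finiteness of `G` is *not* assumed), a
  bounded sequence visits one rhombus infinitely often, every rhombus is the closure of its
  interior, an open subset of one rhombus meets no other rhombus; the **tile across a side**
  (`exists_rhombus_across`) and `cross_nonpos_of_mem_rhombus_across` (near the side it stays in
  the opposite closed half-plane).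
* §3 `RhombicEmbedding.NoTJunction` ⇒ **edge-to-edge** (`exists_dart_across`): the second
  rhombus is over a different edge, has a standard side with the same two endpoints and lies
  across; `ball_subset_union_of_across`, `edge_eq_or_eq_of_mem_rhombus` (no third rhombus at a
  point of an open side).
* §4 Polygonal paths: `chainEnd`, `pieces`, `sidePath a l` (a `Path`), `sideLoop`; the crossing
  defect of a polygonal path is the sum over its pieces (`crossInc_sidePath`), the sum against a
  test segment crossed by one side only (`sum_crossInc_pieces`), and
  `wind_sub_wind_sideLoop`: `wind(ℓ) - wind(r) = N(A,P) - N(P,A)` (`crossInc` API of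
  `Literature.Topology.PlaneTopology.ArgumentIncrement`).
* §5 The test segment between the centres of the two rhombi at a side crosses that side inside
  both open segments and its line separates the two endpoints (`crossing_geometry`).
* §6 `RhombicEmbedding.IsSide`; the **parity identity at one side**
  (`count_add_count_zmod_two`): for a closed walk along sides, the number of traversals of a side
  is congruent mod `2` to the sum of the winding numbers about the centres of its two rhombi.
* §7 **Even side-loops** (`even_length_of_isSideLoop`): a closed walk along sides of rhombi has
  even length (double counting over the sides of the finitely many rhombi near the loop: each
  rhombus has four sides, `card_tileSides`, each side exactly two rhombi; far rhombi have
  winding number zero) — the corner graph of the tiling is bipartite.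
* §8 **Corner consistency** (`z_ne_c_of_noTJunction`): under `G.Preconnected` and
  `NoTJunction`, `emb.z v ≠ emb.c (emb.leftFace d)` for every vertex `v` and dart `d` — a
  coincidence would close the side-chain of a walk of `G` (two sides per edge, `walkChain`) by a
  single side into an odd side-loop.

## References

* G. R. Grimmett, I. Manolescu, *Bond percolation on isoradial graphs: criticality and
  universality*, PTRF 159 (2014) 273–327, arXiv:1204.0505, §2.1 and §4.1 (the diamond graph of an
  isoradial graph is a rhombic tiling; primal and dual graphs read off the bipartite tiling).
* R. Kenyon, J.-M. Schlenker, *Rhombic embeddings of planar quad-graphs*, Trans. AMS 357 (2005),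
  §1 (quad-graphs are bipartite; rhombic embeddings).
* N. G. de Bruijn, *Algebraic theory of Penrose's non-periodic tilings of the plane I*, Indag.
  Math. 43 (1981), §4 (parity in rhombic tilings).
-/

noncomputable section

namespace Literature.Probability.Percolation

open Complex ComplexConjugate Metric Set Filter Topology
open Literature.Probability.LatticeModels IsoradialCriticality Literature.Topology.PlaneTopology

/-! ### §1 Plane geometry of a parallelogram with unit sides -/

namespace RhombicPlanarity

/-- The planar cross product `a × b = Im (ā b) = a.re b.im - a.im b.re`. [folklore] -/
def cross (a b : ℂ) : ℝ := (conj a * b).im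

/-- The planar dot product `a · b = Re (ā b)`. [folklore] -/
def dot (a b : ℂ) : ℝ := (conj a * b).re

/-- The cross product in coordinates. [folklore] -/
theorem cross_apply (a b : ℂ) : cross a b = a.re * b.im - a.im * b.re := by
  simp [cross, Complex.mul_im, Complex.conj_re, Complex.conj_im]; ring

/-- The dot product in coordinates. [folklore] -/
theorem dot_apply (a b : ℂ) : dot a b = a.re * b.re + a.im * b.im := by
  simp [dot, Complex.mul_re, Complex.conj_re, Complex.conj_im]

/-- A vector has zero cross product with itself. [folklore] -/
@[simp] theorem cross_self (a : ℂ) : cross a a = 0 := by rw [cross_apply]; ring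

/-- The cross product is antisymmetric. [folklore] -/
theorem cross_comm (a b : ℂ) : cross a b = -cross b a := by rw [cross_apply, cross_apply]; ring

/-- Cross product with zero. [folklore] -/
@[simp] theorem cross_zero_right (a : ℂ) : cross a 0 = 0 := by simp [cross_apply]

/-- Cross product with zero. [folklore] -/
@[simp] theorem cross_zero_left (a : ℂ) : cross 0 a = 0 := by simp [cross_apply]

/-- Additivity of the cross product (right). [folklore] -/
theorem cross_add_right (a b c : ℂ) : cross a (b + c) = cross a b + cross a c := by
  simp only [cross_apply, Complex.add_re, Complex.add_im]; ring

/-- Subtractivity of the cross product (right). [folklore] -/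
theorem cross_sub_right (a b c : ℂ) : cross a (b - c) = cross a b - cross a c := by
  simp only [cross_apply, Complex.sub_re, Complex.sub_im]; ring

/-- Real homogeneity of the cross product (right). [folklore] -/
theorem cross_ofReal_mul_right (a b : ℂ) (s : ℝ) : cross a ((s : ℂ) * b) = s * cross a b := by
  simp only [cross_apply, Complex.re_ofReal_mul, Complex.im_ofReal_mul]; ring

/-- Real homogeneity of the cross product (left). [folklore] -/
theorem cross_ofReal_mul_left (a b : ℂ) (s : ℝ) : cross ((s : ℂ) * a) b = s * cross a b := by
  simp only [cross_apply, Complex.re_ofReal_mul, Complex.im_ofReal_mul]; ring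

/-- Additivity of the cross product (left). [folklore] -/
theorem cross_add_left (a b c : ℂ) : cross (a + b) c = cross a c + cross b c := by
  simp only [cross_apply, Complex.add_re, Complex.add_im]; ring

/-- Subtractivity of the cross product (left). [folklore] -/
theorem cross_sub_left (a b c : ℂ) : cross (a - b) c = cross a c - cross b c := by
  simp only [cross_apply, Complex.sub_re, Complex.sub_im]; ring

/-- Cross product with a negated vector (right). [folklore] -/
theorem cross_neg_right (a b : ℂ) : cross a (-b) = -cross a b := by
  simp only [cross_apply, Complex.neg_re, Complex.neg_im]; ring

/-- Cross product with a negated vector (left). [folklore] -/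
theorem cross_neg_left (a b : ℂ) : cross (-a) b = -cross a b := by
  simp only [cross_apply, Complex.neg_re, Complex.neg_im]; ring

/-- The dot square is the squared norm. [folklore] -/
theorem dot_self (a : ℂ) : dot a a = ‖a‖ ^ 2 := by
  rw [dot_apply, Complex.sq_norm, Complex.normSq_apply]

/-- `|ā b|² = (a·b)² + (a×b)²`. [folklore] -/
theorem dot_sq_add_cross_sq (a b : ℂ) : dot a b ^ 2 + cross a b ^ 2 = ‖a‖ ^ 2 * ‖b‖ ^ 2 := by
  rw [dot_apply, cross_apply, Complex.sq_norm, Complex.sq_norm, Complex.normSq_apply,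
    Complex.normSq_apply]; ring

/-- **Cramer's rule** in the plane: `(u × w) x = (x × w) u + (u × x) w`. [folklore] -/
theorem cramer (u w x : ℂ) :
    (cross u w : ℂ) * x = (cross x w : ℂ) * u + (cross u x : ℂ) * w := by
  apply Complex.ext <;> simp [cross_apply] <;> ring

/-- Coordinates along a unit vector: `x = (u·x) u + (u×x) (iu)` for `‖u‖ = 1`. [folklore] -/
theorem eq_dot_add_cross_of_norm_eq_one {u : ℂ} (hu : ‖u‖ = 1) (x : ℂ) :
    x = (dot u x : ℂ) * u + (cross u x : ℂ) * (I * u) := by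
  have h1 : u * conj u = 1 := by
    rw [Complex.mul_conj, Complex.normSq_eq_norm_sq, hu]; norm_num
  have : x = u * (conj u * x) := by rw [← mul_assoc, h1, one_mul]
  conv_lhs => rw [this, ← Complex.re_add_im (conj u * x)]
  simp only [dot, cross]; ring

/-- A vector with zero cross product against a unit vector is a real multiple of it. [folklore] -/
theorem eq_dot_mul_of_cross_eq_zero {u : ℂ} (hu : ‖u‖ = 1) {x : ℂ} (hx : cross u x = 0) :
    x = (dot u x : ℂ) * u := by
  have := eq_dot_add_cross_of_norm_eq_one hu x
  rw [hx] at this; simpa using this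

/-- For unit vectors that are not parallel, `|u · w| < 1`. [folklore] -/
theorem abs_dot_lt_one {u w : ℂ} (hu : ‖u‖ = 1) (hw : ‖w‖ = 1) (h : cross u w ≠ 0) :
    |dot u w| < 1 := by
  have hsq := dot_sq_add_cross_sq u w
  rw [hu, hw] at hsq
  have hc : 0 < cross u w ^ 2 := by positivity
  have hd : dot u w ^ 2 < 1 := by nlinarith
  exact (sq_lt_one_iff_abs_lt_one _).1 hd

/-! #### Parallelogram coordinates -/

section Quad

variable {A B P Q : ℂ}

/-- The set of points `A + s (P - A) + t (Q - A)`, `s, t ∈ [0, 1]`, is convex. [folklore] -/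
theorem convex_paraSet (A P Q : ℂ) :
    Convex ℝ {X : ℂ | ∃ s ∈ Icc (0:ℝ) 1, ∃ t ∈ Icc (0:ℝ) 1,
      X = A + (s : ℂ) * (P - A) + (t : ℂ) * (Q - A)} := by
  intro X hX Y hY a b ha hb hab
  obtain ⟨s, ⟨hs0, hs1⟩, t, ⟨ht0, ht1⟩, rfl⟩ := hX
  obtain ⟨s', ⟨hs0', hs1'⟩, t', ⟨ht0', ht1'⟩, rfl⟩ := hY
  refine ⟨a * s + b * s', ⟨by positivity, by nlinarith⟩, a * t + b * t',
    ⟨by positivity, by nlinarith⟩, ?_⟩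
  simp only [Complex.real_smul]
  push_cast
  have hab' : (a : ℂ) + (b : ℂ) = 1 := by exact_mod_cast hab
  linear_combination (A : ℂ) * hab'

/-- **Parallelogram coordinates.** For `P + Q = A + B`, the convex hull of `{A, P, B, Q}` is
the set of points `A + s (P - A) + t (Q - A)` with `s, t ∈ [0, 1]`. [folklore] -/
theorem mem_convexHull_quad_iff (hsum : P + Q = A + B) (X : ℂ) :
    X ∈ convexHull ℝ ({A, P, B, Q} : Set ℂ) ↔
      ∃ s ∈ Icc (0:ℝ) 1, ∃ t ∈ Icc (0:ℝ) 1, X = A + (s : ℂ) * (P - A) + (t : ℂ) * (Q - A) := by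
  constructor
  · intro hX
    have hsub : convexHull ℝ ({A, P, B, Q} : Set ℂ) ⊆ {X : ℂ | ∃ s ∈ Icc (0:ℝ) 1,
        ∃ t ∈ Icc (0:ℝ) 1, X = A + (s : ℂ) * (P - A) + (t : ℂ) * (Q - A)} := by
      refine convexHull_min ?_ (convex_paraSet A P Q)
      intro Y hY
      simp only [mem_insert_iff, mem_singleton_iff] at hY
      rcases hY with rfl | rfl | rfl | rfl
      · exact ⟨0, ⟨le_rfl, zero_le_one⟩, 0, ⟨le_rfl, zero_le_one⟩, by push_cast; ring⟩
      · exact ⟨1, ⟨zero_le_one, le_rfl⟩, 0, ⟨le_rfl, zero_le_one⟩, by push_cast; ring⟩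
      · refine ⟨1, ⟨zero_le_one, le_rfl⟩, 1, ⟨zero_le_one, le_rfl⟩, ?_⟩
        push_cast; linear_combination (-1 : ℂ) * hsum
      · exact ⟨0, ⟨le_rfl, zero_le_one⟩, 1, ⟨zero_le_one, le_rfl⟩, by push_cast; ring⟩
    exact hsub hX
  · rintro ⟨s, ⟨hs0, hs1⟩, t, ⟨ht0, ht1⟩, rfl⟩
    have hconv : Convex ℝ (convexHull ℝ ({A, P, B, Q} : Set ℂ)) := convex_convexHull ℝ _
    obtain ⟨hAin, hPin, hBin, hQin⟩ := corners_mem_convexHull_quad A P B Q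
    -- bilinear weights
    have key : ((1 - s) * (1 - t)) • A + (s * (1 - t)) • P + (s * t) • B + ((1 - s) * t) • Q ∈
        convexHull ℝ ({A, P, B, Q} : Set ℂ) := by
      have h := hconv.sum_mem (t := Finset.univ)
        (w := ![(1 - s) * (1 - t), s * (1 - t), s * t, (1 - s) * t]) (z := ![A, P, B, Q])
        (by intro i _; fin_cases i <;> simp <;> nlinarith)
        (by simp [Fin.sum_univ_four]; ring)
        (by intro i _; fin_cases i <;> simp [hAin, hPin, hBin, hQin])
      simpa [Fin.sum_univ_four] using h
    have hw_eq : A + (s : ℂ) * (P - A) + (t : ℂ) * (Q - A) =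
        ((1 - s) * (1 - t)) • A + (s * (1 - t)) • P + (s * t) • B + ((1 - s) * t) • Q := by
      simp only [Complex.real_smul]
      push_cast
      linear_combination ((s : ℂ) * t) * hsum
    rw [hw_eq]
    exact key

/-- Uniqueness of parallelogram coordinates (the side vectors are not parallel). [folklore] -/
theorem para_coords_unique {u w : ℂ} (huw : cross u w ≠ 0) {s t s' t' : ℝ}
    (h : (s : ℂ) * u + (t : ℂ) * w = (s' : ℂ) * u + (t' : ℂ) * w) : s = s' ∧ t = t' := by
  have h1 := congrArg (cross u) h
  have h2 := congrArg (fun x => cross x w) h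
  simp only [cross_add_right, cross_ofReal_mul_right, cross_self, mul_zero, zero_add] at h1
  simp only [cross_add_left, cross_ofReal_mul_left, cross_self, mul_zero, add_zero] at h2
  exact ⟨mul_right_cancel₀ huw h2, mul_right_cancel₀ huw h1⟩

/-- The coordinates of a point: `X - A = s u + t w` with `s = (X-A) × w / (u × w)` and
`t = u × (X-A) / (u × w)`. [folklore] -/
theorem para_coords_eq {u w : ℂ} (huw : cross u w ≠ 0) (x : ℂ) :
    x = ((cross x w / cross u w : ℝ) : ℂ) * u + ((cross u x / cross u w : ℝ) : ℂ) * w := by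
  have h := cramer u w x
  have hc : (cross u w : ℂ) ≠ 0 := by exact_mod_cast huw
  push_cast
  field_simp
  linear_combination h

/-- In a non-degenerate rhombus the side vectors at a corner are not parallel. [folklore] -/
theorem cross_ne_zero_of_quad (hsum : P + Q = A + B) (hAB : A ≠ B) (hPQ : P ≠ Q)
    (hAP : ‖A - P‖ = 1) (hBP : ‖B - P‖ = 1) : cross (P - A) (Q - A) ≠ 0 := by
  intro h0
  -- if parallel, `Q - A = λ (P - A)` with `|λ| = 1`, forcing `Q = P` or `B = A`
  have hu : ‖P - A‖ = 1 := by rw [norm_sub_rev]; exact hAP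
  have hAQ : ‖Q - A‖ = 1 := by
    have : Q - A = B - P := by linear_combination hsum
    rw [this, hBP]
  have hQ := eq_dot_mul_of_cross_eq_zero hu h0
  have hl : |dot (P - A) (Q - A)| = 1 := by
    have := congrArg norm hQ
    rw [hAQ, norm_mul, Complex.norm_real, hu, mul_one, Real.norm_eq_abs] at this
    exact this.symm
  rcases abs_eq (zero_le_one) |>.1 hl with h1 | h1
  · rw [h1] at hQ; push_cast at hQ; rw [one_mul] at hQ
    exact hPQ (sub_left_injective hQ).symm
  · rw [h1] at hQ; push_cast at hQ
    apply hAB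
    linear_combination hsum - hQ

/-- Centre coordinates versus corner coordinates:
`A + s (P - A) + t (Q - A) = M + (1 - s - t) a + (s - t) p`. [folklore] -/
theorem corner_coords_eq_centre_coords (hsum : P + Q = A + B) (s t : ℝ) :
    A + (s : ℂ) * (P - A) + (t : ℂ) * (Q - A) =
      (A + B) / 2 + ((1 - s - t : ℝ) : ℂ) * ((A - B) / 2) + ((s - t : ℝ) : ℂ) * ((P - Q) / 2) := by
  push_cast
  linear_combination (((s : ℂ) + t) / 2) * hsum

/-- **Inner points are interior.** `A + s (P - A) + t (Q - A)` with `0 < s, t < 1` lies in the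
interior of the rhombus. [folklore] -/
theorem mem_interior_quad_of_coords (hsum : P + Q = A + B) (hAB : A ≠ B) (hPQ : P ≠ Q)
    (hAP : ‖A - P‖ = 1) (hBP : ‖B - P‖ = 1) {s t : ℝ} (hs0 : 0 < s) (hs1 : s < 1)
    (ht0 : 0 < t) (ht1 : t < 1) :
    A + (s : ℂ) * (P - A) + (t : ℂ) * (Q - A) ∈ interior (convexHull ℝ ({A, P, B, Q} : Set ℂ)) := by
  rw [corner_coords_eq_centre_coords hsum]
  have hst : |1 - s - t| + |s - t| < 1 := by
    rcases le_or_gt 0 (1 - s - t) with h | h <;> rcases le_or_gt 0 (s - t) with h' | h'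
    · rw [abs_of_nonneg h, abs_of_nonneg h']; linarith
    · rw [abs_of_nonneg h, abs_of_neg h']; linarith
    · rw [abs_of_neg h, abs_of_nonneg h']; linarith
    · rw [abs_of_neg h, abs_of_neg h']; linarith
  have ha : 0 < ‖(A - B) / 2‖ := by
    rw [norm_pos_iff]; intro h
    rcases div_eq_zero_iff.1 h with h | h
    · exact hAB (sub_eq_zero.1 h)
    · norm_num at h
  have hp : 0 < ‖(P - Q) / 2‖ := by
    rw [norm_pos_iff]; intro h
    rcases div_eq_zero_iff.1 h with h | h
    · exact hPQ (sub_eq_zero.1 h)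
    · norm_num at h
  have hr : 0 < (1 - (|1 - s - t| + |s - t|)) * (‖(A - B) / 2‖ * ‖(P - Q) / 2‖) := by
    have : 0 < 1 - (|1 - s - t| + |s - t|) := by linarith
    positivity
  exact mem_interior_of_ball_subset hr (ball_subset_convexHull_quad hsum hAB hPQ hAP hBP hst)

/-- **The rhombus lies in the closed half-plane of each side**: for `X` in the rhombus,
`(P - A) × (X - A)` has the sign of `(P - A) × (Q - A)` (weakly). [folklore] -/
theorem cross_mul_cross_nonneg_of_mem (hsum : P + Q = A + B) {X : ℂ}
    (hX : X ∈ convexHull ℝ ({A, P, B, Q} : Set ℂ)) :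
    0 ≤ cross (P - A) (X - A) * cross (P - A) (Q - A) := by
  obtain ⟨s, -, t, ⟨ht0, -⟩, rfl⟩ := (mem_convexHull_quad_iff hsum X).1 hX
  have : A + (s : ℂ) * (P - A) + (t : ℂ) * (Q - A) - A = (s : ℂ) * (P - A) + (t : ℂ) * (Q - A) := by
    ring
  rw [this, cross_add_right, cross_ofReal_mul_right, cross_ofReal_mul_right, cross_self,
    mul_zero, zero_add]
  have := sq_nonneg (cross (P - A) (Q - A))
  nlinarith

/-- **Side points are not interior**: a point `X` with `(P - A) × (X - A) = 0` (on the line of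
the side `[A, P]`) is not an interior point of the rhombus. [folklore] -/
theorem not_mem_interior_quad_of_cross_eq_zero (hsum : P + Q = A + B) (hAB : A ≠ B)
    (hPQ : P ≠ Q) (hAP : ‖A - P‖ = 1) (hBP : ‖B - P‖ = 1) {X : ℂ}
    (hX : cross (P - A) (X - A) = 0) :
    X ∉ interior (convexHull ℝ ({A, P, B, Q} : Set ℂ)) := by
  intro hXi
  have hc := cross_ne_zero_of_quad hsum hAB hPQ hAP hBP
  rw [mem_interior_iff_mem_nhds, Metric.mem_nhds_iff] at hXi
  obtain ⟨δ, hδ, hsub⟩ := hXi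
  -- move a little against the inward normal
  set σ : ℝ := cross (P - A) (Q - A) with hσ
  set Y : ℂ := X - ((δ / 2 * σ / |σ| : ℝ) : ℂ) * (I * (P - A)) with hY
  have hu : ‖P - A‖ = 1 := by rw [norm_sub_rev]; exact hAP
  have hYball : Y ∈ ball X δ := by
    rw [mem_ball, dist_eq_norm, hY, sub_sub_cancel_left, norm_neg, norm_mul, Complex.norm_real,
      norm_mul, Complex.norm_I, one_mul, hu, mul_one, Real.norm_eq_abs, abs_div, abs_mul,
      abs_abs, abs_of_pos (by positivity : (0:ℝ) < δ / 2)]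
    rw [mul_div_assoc, div_self (abs_ne_zero.2 hc), mul_one]
    linarith
  have hYK := cross_mul_cross_nonneg_of_mem hsum (hsub hYball)
  have hcr : cross (P - A) (Y - A) = -(δ / 2 * σ / |σ|) := by
    have : Y - A = (X - A) - ((δ / 2 * σ / |σ| : ℝ) : ℂ) * (I * (P - A)) := by rw [hY]; ring
    rw [this, cross_sub_right, hX, cross_ofReal_mul_right, zero_sub]
    congr 1
    have hI : cross (P - A) (I * (P - A)) = ‖P - A‖ ^ 2 := by
      rw [cross_apply, Complex.sq_norm, Complex.normSq_apply]; simp; ring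
    rw [hI, hu]; ring
  rw [hcr, ← hσ] at hYK
  have hσ2 : σ * σ = |σ| * |σ| := (abs_mul_abs_self σ).symm
  have hapos : 0 < |σ| := abs_pos.2 hc
  have : -(δ / 2 * σ / |σ|) * σ = -(δ / 2) * |σ| := by
    field_simp; linarith [hσ2]
  rw [this] at hYK
  nlinarith

/-- **Boundary points lie on a side.** A point of the rhombus that is not interior lies on one
of the four closed sides. [folklore] -/
theorem mem_sides_of_not_mem_interior (hsum : P + Q = A + B) (hAB : A ≠ B) (hPQ : P ≠ Q)
    (hAP : ‖A - P‖ = 1) (hBP : ‖B - P‖ = 1) {X : ℂ}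
    (hX : X ∈ convexHull ℝ ({A, P, B, Q} : Set ℂ))
    (hXi : X ∉ interior (convexHull ℝ ({A, P, B, Q} : Set ℂ))) :
    X ∈ segment ℝ A P ∨ X ∈ segment ℝ P B ∨ X ∈ segment ℝ B Q ∨ X ∈ segment ℝ Q A := by
  obtain ⟨s, ⟨hs0, hs1⟩, t, ⟨ht0, ht1⟩, rfl⟩ := (mem_convexHull_quad_iff hsum X).1 hX
  have hB : B = P + Q - A := by linear_combination (-1 : ℂ) * hsum
  by_cases hs : s = 0
  · -- on `[Q, A]`
    refine Or.inr (Or.inr (Or.inr ⟨t, 1 - t, ht0, by linarith, by ring, ?_⟩))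
    subst hs; simp only [Complex.real_smul]; push_cast; ring
  by_cases hs' : s = 1
  · -- on `[P, B]`
    refine Or.inr (Or.inl ⟨1 - t, t, by linarith, ht0, by ring, ?_⟩)
    subst hs'; rw [hB]; simp only [Complex.real_smul]; push_cast; ring
  by_cases ht : t = 0
  · -- on `[A, P]`
    refine Or.inl ⟨1 - s, s, by linarith, hs0, by ring, ?_⟩
    subst ht; simp only [Complex.real_smul]; push_cast; ring
  by_cases ht' : t = 1
  · -- on `[B, Q]`
    refine Or.inr (Or.inr (Or.inl ⟨s, 1 - s, hs0, by linarith, by ring, ?_⟩))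
    subst ht'; rw [hB]; simp only [Complex.real_smul]; push_cast; ring
  exact absurd (mem_interior_quad_of_coords hsum hAB hPQ hAP hBP (lt_of_le_of_ne hs0 (Ne.symm hs))
    (lt_of_le_of_ne hs1 hs') (lt_of_le_of_ne ht0 (Ne.symm ht)) (lt_of_le_of_ne ht1 ht')) hXi

/-- **Half-disc lemma.** Near a point `ρ` of the open side `(A, P)`, every point of the closed
half-plane of that side containing the rhombus belongs to the rhombus. [folklore] -/
theorem exists_ball_inter_halfPlane_subset_quad (hsum : P + Q = A + B) (hAB : A ≠ B)
    (hPQ : P ≠ Q) (hAP : ‖A - P‖ = 1) (hBP : ‖B - P‖ = 1) {ρ : ℂ} (hρ : ρ ∈ openSegment ℝ A P) :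
    ∃ δ > 0, ∀ X, dist X ρ < δ → 0 ≤ cross (P - A) (X - A) * cross (P - A) (Q - A) →
      X ∈ convexHull ℝ ({A, P, B, Q} : Set ℂ) := by
  have hc := cross_ne_zero_of_quad hsum hAB hPQ hAP hBP
  set u : ℂ := P - A with hu_def
  set w : ℂ := Q - A with hw_def
  obtain ⟨a, b, ha, hb, hab, hρeq⟩ := hρ
  -- `ρ = A + b u`
  have hab' : (a : ℂ) + b = 1 := by exact_mod_cast hab
  have hρA : ρ - A = (b : ℂ) * u := by
    rw [← hρeq]; simp only [Complex.real_smul, hu_def]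
    linear_combination (A : ℂ) * hab'
  -- coordinates are Lipschitz in `X`
  set C : ℝ := (‖w‖ + ‖u‖) / |cross u w| with hC
  have hCpos : 0 < C := by
    have : 0 < ‖u‖ := by rw [hu_def, norm_sub_rev, hAP]; norm_num
    have hapos : 0 < |cross u w| := abs_pos.2 hc
    positivity
  set m : ℝ := min b (1 - b) with hm
  have hmpos : 0 < m := lt_min hb (by linarith)
  refine ⟨m / C, div_pos hmpos hCpos, fun X hX hside => ?_⟩
  rw [mem_convexHull_quad_iff hsum]
  -- coordinates of `X - A`
  set s : ℝ := cross (X - A) w / cross u w with hs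
  set t : ℝ := cross u (X - A) / cross u w with ht
  have hXeq : X - A = (s : ℂ) * u + (t : ℂ) * w := para_coords_eq hc (X - A)
  -- coordinates of `ρ - A` are `(b, 0)`; compare
  have hdiff : X - ρ = ((s - b : ℝ) : ℂ) * u + (t : ℂ) * w := by
    have : X - ρ = (X - A) - (ρ - A) := by ring
    rw [this, hXeq, hρA]; push_cast; ring
  have hsb : |s - b| ≤ ‖X - ρ‖ * ‖w‖ / |cross u w| := by
    have h1 := congrArg (fun x => cross x w) hdiff
    simp only [cross_add_left, cross_ofReal_mul_left, cross_self, mul_zero, add_zero] at h1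
    -- `cross (X - ρ) w = (s - b) * cross u w`
    have h2 : |cross (X - ρ) w| ≤ ‖X - ρ‖ * ‖w‖ := by
      have := dot_sq_add_cross_sq (X - ρ) w
      have h3 : cross (X - ρ) w ^ 2 ≤ (‖X - ρ‖ * ‖w‖) ^ 2 := by
        nlinarith [sq_nonneg (dot (X - ρ) w)]
      exact abs_le.2 ⟨(abs_le_of_sq_le_sq' h3 (by positivity)).1,
        (abs_le_of_sq_le_sq' h3 (by positivity)).2⟩
    rw [h1, abs_mul] at h2
    rw [le_div_iff₀ (abs_pos.2 hc)]
    linarith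
  have htb : |t| ≤ ‖X - ρ‖ * ‖u‖ / |cross u w| := by
    have h1 := congrArg (cross u) hdiff
    simp only [cross_add_right, cross_ofReal_mul_right, cross_self, mul_zero, zero_add] at h1
    have h2 : |cross u (X - ρ)| ≤ ‖u‖ * ‖X - ρ‖ := by
      have := dot_sq_add_cross_sq u (X - ρ)
      have h3 : cross u (X - ρ) ^ 2 ≤ (‖u‖ * ‖X - ρ‖) ^ 2 := by nlinarith [sq_nonneg (dot u (X - ρ))]
      exact abs_le.2 ⟨(abs_le_of_sq_le_sq' h3 (by positivity)).1,
        (abs_le_of_sq_le_sq' h3 (by positivity)).2⟩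
    rw [h1, abs_mul] at h2
    rw [le_div_iff₀ (abs_pos.2 hc)]
    linarith
  have hXρ : ‖X - ρ‖ < m / C := by rwa [← dist_eq_norm]
  have hbound : ‖X - ρ‖ * (‖w‖ + ‖u‖) / |cross u w| < m := by
    have : ‖X - ρ‖ * (‖w‖ + ‖u‖) / |cross u w| = ‖X - ρ‖ * C := by rw [hC]; ring
    rw [this]
    calc ‖X - ρ‖ * C < m / C * C := mul_lt_mul_of_pos_right hXρ hCpos
      _ = m := div_mul_cancel₀ m hCpos.ne'
  have hsb' : |s - b| < m := by
    refine lt_of_le_of_lt hsb (lt_of_le_of_lt ?_ hbound)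
    rw [div_le_div_iff_of_pos_right (abs_pos.2 hc)]
    nlinarith [norm_nonneg (X - ρ), norm_nonneg u]
  have htb' : |t| < m := by
    refine lt_of_le_of_lt htb (lt_of_le_of_lt ?_ hbound)
    rw [div_le_div_iff_of_pos_right (abs_pos.2 hc)]
    nlinarith [norm_nonneg (X - ρ), norm_nonneg w]
  -- `t ≥ 0` from the half-plane condition
  have ht0 : 0 ≤ t := by
    have : cross u (X - A) = t * cross u w := by
      rw [ht]; field_simp
    rw [this] at hside
    have hpos : 0 < cross u w * cross u w := mul_self_pos.2 hc
    nlinarith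
  refine ⟨s, ⟨?_, ?_⟩, t, ⟨ht0, ?_⟩, ?_⟩
  · have := (abs_lt.1 hsb').1; have := min_le_left b (1 - b); linarith
  · have := (abs_lt.1 hsb').2; have := min_le_right b (1 - b); linarith
  · have := (abs_lt.1 htb').2; have := min_le_right b (1 - b); have := min_le_left b (1 - b)
    linarith
  · linear_combination hXeq

/-- A point of the open side `(A, P)` lies on no other closed side of the parallelogram.
[folklore] -/
theorem not_mem_other_sides_of_mem_openSegment (hsum : P + Q = A + B) (hAB : A ≠ B)
    (hPQ : P ≠ Q) (hAP : ‖A - P‖ = 1) (hBP : ‖B - P‖ = 1) {X : ℂ} (hX : X ∈ openSegment ℝ A P) :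
    X ∉ segment ℝ P B ∧ X ∉ segment ℝ B Q ∧ X ∉ segment ℝ Q A := by
  have hc := cross_ne_zero_of_quad hsum hAB hPQ hAP hBP
  have hB : B = A + (P - A) + (Q - A) := by linear_combination (-1 : ℂ) * hsum
  obtain ⟨a, θ, ha, hθ, haθ, rfl⟩ := hX
  have haθ' : (a : ℂ) + θ = 1 := by exact_mod_cast haθ
  -- coordinates `(θ, 0)`
  have hXc : a • A + θ • P - A = (θ : ℂ) * (P - A) + ((0:ℝ) : ℂ) * (Q - A) := by
    simp only [Complex.real_smul]; push_cast
    linear_combination (A : ℂ) * haθ'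
  refine ⟨?_, ?_, ?_⟩
  · rintro ⟨a', t, ha', ht, hat, hXeq⟩
    have hat' : (a' : ℂ) + t = 1 := by exact_mod_cast hat
    have : a' • P + t • B - A = ((1:ℝ) : ℂ) * (P - A) + (t : ℂ) * (Q - A) := by
      rw [hB]; simp only [Complex.real_smul]; push_cast
      linear_combination (P : ℂ) * hat'
    have h := para_coords_unique hc (hXc.symm.trans (by rw [← hXeq]; exact this))
    linarith [h.1]
  · rintro ⟨a', t, ha', ht, hat, hXeq⟩
    have hat' : (a' : ℂ) + t = 1 := by exact_mod_cast hat
    have : a' • B + t • Q - A = (a' : ℂ) * (P - A) + ((1:ℝ) : ℂ) * (Q - A) := by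
      rw [hB]; simp only [Complex.real_smul]; push_cast
      linear_combination (Q : ℂ) * hat'
    have h := para_coords_unique hc (hXc.symm.trans (by rw [← hXeq]; exact this))
    linarith [h.2]
  · rintro ⟨a', t, ha', ht, hat, hXeq⟩
    have hat' : (a' : ℂ) + t = 1 := by exact_mod_cast hat
    have : a' • Q + t • A - A = ((0:ℝ) : ℂ) * (P - A) + (a' : ℂ) * (Q - A) := by
      simp only [Complex.real_smul]; push_cast
      linear_combination (A : ℂ) * hat'
    have h := para_coords_unique hc (hXc.symm.trans (by rw [← hXeq]; exact this))
    linarith [h.1]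

/-- Points of the closed side `[A, P]` are not interior. [folklore] -/
theorem not_mem_interior_quad_of_mem_segment (hsum : P + Q = A + B) (hAB : A ≠ B)
    (hPQ : P ≠ Q) (hAP : ‖A - P‖ = 1) (hBP : ‖B - P‖ = 1) {X : ℂ} (hX : X ∈ segment ℝ A P) :
    X ∉ interior (convexHull ℝ ({A, P, B, Q} : Set ℂ)) := by
  refine not_mem_interior_quad_of_cross_eq_zero hsum hAB hPQ hAP hBP ?_
  obtain ⟨a, b, -, -, hab, rfl⟩ := hX
  have hab' : (a : ℂ) + b = 1 := by exact_mod_cast hab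
  have : a • A + b • P - A = (b : ℂ) * (P - A) := by
    simp only [Complex.real_smul]
    linear_combination (A : ℂ) * hab'
  rw [this, cross_ofReal_mul_right, cross_self, mul_zero]

/-- The corner set is symmetric in the two face centres. [folklore] -/
theorem quad_swap_PQ (A P B Q : ℂ) : ({A, Q, B, P} : Set ℂ) = {A, P, B, Q} := by
  ext X; simp only [mem_insert_iff, mem_singleton_iff]; tauto

/-- The corner set read from the opposite vertex. [folklore] -/
theorem quad_swap_AB (A P B Q : ℂ) : ({B, P, A, Q} : Set ℂ) = {A, P, B, Q} := by
  ext X; simp only [mem_insert_iff, mem_singleton_iff]; tauto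

/-- **No point of any closed side is interior.** [folklore] -/
theorem not_mem_interior_quad_of_mem_side (hsum : P + Q = A + B) (hAB : A ≠ B) (hPQ : P ≠ Q)
    (hAP : ‖A - P‖ = 1) (hBP : ‖B - P‖ = 1) {X : ℂ}
    (hX : X ∈ segment ℝ A P ∨ X ∈ segment ℝ P B ∨ X ∈ segment ℝ B Q ∨ X ∈ segment ℝ Q A) :
    X ∉ interior (convexHull ℝ ({A, P, B, Q} : Set ℂ)) := by
  have hAQ : ‖A - Q‖ = 1 := by
    have : A - Q = -(B - P) := by linear_combination (-1 : ℂ) * hsum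
    rw [this, norm_neg, hBP]
  have hBQ : ‖B - Q‖ = 1 := by
    have : B - Q = -(A - P) := by linear_combination (-1 : ℂ) * hsum
    rw [this, norm_neg, hAP]
  rcases hX with h | h | h | h
  · exact not_mem_interior_quad_of_mem_segment hsum hAB hPQ hAP hBP h
  · -- side `[P, B]`: quad from `B`
    rw [← quad_swap_AB]
    rw [segment_symm] at h
    exact not_mem_interior_quad_of_mem_segment (by linear_combination hsum) hAB.symm hPQ hBP hAP h
  · -- side `[B, Q]`: quad from `B`, faces swapped
    rw [← quad_swap_AB, ← quad_swap_PQ]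
    exact not_mem_interior_quad_of_mem_segment (by linear_combination hsum) hAB.symm hPQ.symm
      hBQ hAQ h
  · -- side `[Q, A]`: faces swapped
    rw [← quad_swap_PQ]
    rw [segment_symm] at h
    exact not_mem_interior_quad_of_mem_segment (by linear_combination hsum) hAB hPQ.symm hAQ hBQ h

/-- The rhombus has diameter at most `2` from the corner `A`. [folklore] -/
theorem norm_sub_le_two_of_mem_quad (hsum : P + Q = A + B) (hAP : ‖A - P‖ = 1)
    (hBP : ‖B - P‖ = 1) {X : ℂ} (hX : X ∈ convexHull ℝ ({A, P, B, Q} : Set ℂ)) :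
    ‖X - A‖ ≤ 2 := by
  obtain ⟨s, ⟨hs0, hs1⟩, t, ⟨ht0, ht1⟩, rfl⟩ := (mem_convexHull_quad_iff hsum X).1 hX
  have hu : ‖P - A‖ = 1 := by rw [norm_sub_rev, hAP]
  have hw : ‖Q - A‖ = 1 := by
    have : Q - A = B - P := by linear_combination hsum
    rw [this, hBP]
  have : A + (s : ℂ) * (P - A) + (t : ℂ) * (Q - A) - A = (s : ℂ) * (P - A) + (t : ℂ) * (Q - A) := by
    ring
  rw [this]
  calc ‖(s : ℂ) * (P - A) + (t : ℂ) * (Q - A)‖ ≤ ‖(s : ℂ) * (P - A)‖ + ‖(t : ℂ) * (Q - A)‖ :=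
        norm_add_le _ _
    _ = s + t := by
        rw [norm_mul, norm_mul, Complex.norm_real, Complex.norm_real, hu, hw, Real.norm_eq_abs,
          Real.norm_eq_abs, abs_of_nonneg hs0, abs_of_nonneg ht0]; ring
    _ ≤ 2 := by linarith

end Quad

end RhombicPlanarity

/-! ### §2 The tiling near a point -/

section Emb

open RhombicPlanarity

variable {V F : Type*} {G : SimpleGraph V} {emb : RhombicEmbedding G F} {ε : ℝ}

/-- The face of the dart `d` selected by a Boolean: `true ↦ leftFace d`, `false ↦ rightFace d`.
With `d ∈ {d₀, d₀.symm}` and `b ∈ {true, false}` the segments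
`[z d.fst, c (dartFace d b)]` are the four sides of the rhombus of `d₀`. [folklore] -/
def _root_.Literature.Probability.LatticeModels.RhombicEmbedding.dartFace
    (emb : RhombicEmbedding G F) (d : G.Dart) (b : Bool) : F :=
  if b then emb.leftFace d else emb.rightFace d

/-- `dartFace d true` is the left face. [folklore] -/
@[simp] theorem dartFace_true (d : G.Dart) : emb.dartFace d true = emb.leftFace d := rfl

/-- `dartFace d false` is the right face. [folklore] -/
@[simp] theorem dartFace_false (d : G.Dart) : emb.dartFace d false = emb.rightFace d := rfl

/-- The two face centres of a dart sum to the two endpoints (diagonals bisect each other). [folklore] -/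
theorem dartFace_not (hiso : emb.IsIsoradial) (d : G.Dart) (b : Bool) :
    emb.c (emb.dartFace d b) + emb.c (emb.dartFace d (!b)) = emb.z d.fst + emb.z d.snd := by
  cases b
  · simp only [dartFace_false, Bool.not_false, dartFace_true]
    rw [add_comm]; exact hiso.c_leftFace_add_c_rightFace d
  · simp only [dartFace_true, Bool.not_true, dartFace_false]
    exact hiso.c_leftFace_add_c_rightFace d

/-- Faces of the reversed dart. [folklore] -/
theorem dartFace_symm (hiso : emb.IsIsoradial) (d : G.Dart) (b : Bool) :
    emb.dartFace d.symm b = emb.dartFace d (!b) := by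
  cases b
  · simp only [dartFace_false, Bool.not_false, dartFace_true]
    have h := hiso.leftFace_symm d.symm
    rw [SimpleGraph.Dart.symm_symm] at h
    exact h.symm
  · simp only [dartFace_true, Bool.not_true, dartFace_false]
    exact hiso.leftFace_symm d

/-- **The rhombus data of a dart and a face choice**: with `A = z d.fst`, `P = c (dartFace d b)`,
`B = z d.snd`, `Q = c (dartFace d (!b))`: `P + Q = A + B`, `A ≠ B`, `P ≠ Q`,
`‖A - P‖ = ‖B - P‖ = 1`. [folklore] -/
theorem dart_quad' (hiso : emb.IsIsoradial) (d : G.Dart) (b : Bool) :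
    emb.c (emb.dartFace d b) + emb.c (emb.dartFace d (!b)) = emb.z d.fst + emb.z d.snd ∧
      emb.z d.fst ≠ emb.z d.snd ∧ emb.c (emb.dartFace d b) ≠ emb.c (emb.dartFace d (!b)) ∧
      ‖emb.z d.fst - emb.c (emb.dartFace d b)‖ = 1 ∧ ‖emb.z d.snd - emb.c (emb.dartFace d b)‖ = 1 := by
  obtain ⟨hsum, hAB, hPQ, hAP, hBP⟩ := dart_quad hiso d
  refine ⟨dartFace_not hiso d b, hAB, ?_, ?_, ?_⟩
  · cases b
    · simpa using hPQ.symm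
    · simpa using hPQ
  · cases b
    · exact norm_z_fst_sub_c_rightFace hiso d
    · exact hAP
  · cases b
    · simp only [dartFace_false]
      have : emb.z d.snd - emb.c (emb.rightFace d) = -(emb.z d.fst - emb.c (emb.leftFace d)) := by
        linear_combination (-1 : ℂ) * hsum
      rw [this, norm_neg, hAP]
    · exact hBP

/-- The rhombus of `d` presented from the side `(z d.fst, c (dartFace d b))`. [folklore] -/
theorem rhombus_eq_quad (hiso : emb.IsIsoradial) (d : G.Dart) (b : Bool) :
    emb.rhombus ⟨d.edge, d.edge_mem⟩ = convexHull ℝ {emb.z d.fst, emb.c (emb.dartFace d b),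
      emb.z d.snd, emb.c (emb.dartFace d (!b))} := by
  rw [rhombus_dart_eq hiso d]
  cases b
  · simp only [dartFace_false, Bool.not_false, dartFace_true]; rw [quad_swap_PQ]
  · simp only [dartFace_true, Bool.not_true, dartFace_false]

/-- The corner set of the rhombus of a dart. [folklore] -/
theorem mem_corners_iff (hiso : emb.IsIsoradial) (d : G.Dart) (b : Bool) (X : ℂ) :
    X ∈ ({emb.z d.fst, emb.z d.snd, emb.c (emb.leftFace d), emb.c (emb.rightFace d)} : Set ℂ) ↔
      X = emb.z d.fst ∨ X = emb.c (emb.dartFace d b) ∨ X = emb.z d.snd ∨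
        X = emb.c (emb.dartFace d (!b)) := by
  have := hiso
  simp only [mem_insert_iff, mem_singleton_iff]
  cases b <;> simp <;> tauto

/-- **A rhombus lies within distance `2` of its reference vertex.** [folklore] -/
theorem norm_sub_z_le_two_of_mem_rhombus (hiso : emb.IsIsoradial) {d : G.Dart} {X : ℂ}
    (hX : X ∈ emb.rhombus ⟨d.edge, d.edge_mem⟩) : ‖X - emb.z d.fst‖ ≤ 2 := by
  obtain ⟨hsum, -, -, hAP, hBP⟩ := dart_quad hiso d
  rw [rhombus_dart_eq hiso d] at hX
  exact norm_sub_le_two_of_mem_quad hsum hAP hBP hX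

/-- Every edge is the edge of its reference dart (as an element of the edge set). [folklore] -/
theorem edge_refDart (e : G.edgeSet) :
    (⟨(RhombicEmbedding.refDart e).edge, (RhombicEmbedding.refDart e).edge_mem⟩ : G.edgeSet) = e :=
  Subtype.ext (RhombicEmbedding.refDart_edge e)

/-- **Local finiteness of the tiling**: only finitely many rhombi meet a bounded set (no local
finiteness of `G` is assumed: it follows). [cite: GrimmettManolescu2014Isoradial, §4.4 Prop. 7 (equivalence of metrics)] -/
theorem finite_setOf_rhombus_meets (hiso : emb.IsIsoradial) (hrh : emb.IsRhombicTiling)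
    (hbap : emb.HasBoundedAngles ε) (hε : 0 < ε) (hnb : ∀ v : V, ∃ u, G.Adj v u) (w₀ : ℂ)
    (R : ℝ) : {e : G.edgeSet | ∃ X ∈ emb.rhombus e, ‖X - w₀‖ ≤ R}.Finite := by
  set S : Set V := {v | (emb.z v - w₀).boxNorm ≤ R + 2} with hS
  set S' : Set V := {v | (emb.z v - w₀).boxNorm ≤ R + 4} with hS'
  have hSf : S.Finite := finite_setOf_boxNorm_le hiso hrh hbap hε hnb w₀ (R + 2)
  have hS'f : S'.Finite := finite_setOf_boxNorm_le hiso hrh hbap hε hnb w₀ (R + 4)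
  set φ : G.edgeSet → V × V := fun e =>
    ((RhombicEmbedding.refDart e).fst, (RhombicEmbedding.refDart e).snd) with hφ
  have hinj : Function.Injective φ := by
    intro e e' h
    simp only [hφ, Prod.mk.injEq] at h
    rw [← edge_refDart e, ← edge_refDart e']
    apply Subtype.ext
    simp only [SimpleGraph.Dart.edge]
    rw [show (RhombicEmbedding.refDart e).toProd = (RhombicEmbedding.refDart e').toProd from
      Prod.ext h.1 h.2]
  refine ((hSf.prod hS'f).preimage hinj.injOn).subset ?_
  rintro e ⟨X, hX, hXw⟩
  set d := RhombicEmbedding.refDart e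
  have hXe : X ∈ emb.rhombus ⟨d.edge, d.edge_mem⟩ := by rw [edge_refDart]; exact hX
  have h1 : ‖X - emb.z d.fst‖ ≤ 2 := norm_sub_z_le_two_of_mem_rhombus hiso hXe
  have h2 : ‖emb.z d.fst - emb.z d.snd‖ < 2 := norm_z_sub_z_lt_two hiso d
  simp only [mem_preimage, mem_prod, hS, hS', mem_setOf_eq, hφ]
  constructor
  · refine (boxNorm_le_norm _).trans ?_
    calc ‖emb.z d.fst - w₀‖ = ‖(X - w₀) - (X - emb.z d.fst)‖ := by ring_nf
      _ ≤ ‖X - w₀‖ + ‖X - emb.z d.fst‖ := norm_sub_le _ _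
      _ ≤ R + 2 := by linarith
  · refine (boxNorm_le_norm _).trans ?_
    calc ‖emb.z d.snd - w₀‖ = ‖(X - w₀) - (X - emb.z d.fst) - (emb.z d.fst - emb.z d.snd)‖ := by
          ring_nf
      _ ≤ ‖(X - w₀) - (X - emb.z d.fst)‖ + ‖emb.z d.fst - emb.z d.snd‖ := norm_sub_le _ _
      _ ≤ ‖X - w₀‖ + ‖X - emb.z d.fst‖ + ‖emb.z d.fst - emb.z d.snd‖ := by
          linarith [norm_sub_le (X - w₀) (X - emb.z d.fst)]
      _ ≤ R + 4 := by linarith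

/-- **A bounded sequence visits one rhombus infinitely often** (cover + pigeonhole). [folklore] -/
theorem exists_rhombus_frequently (hiso : emb.IsIsoradial) (hrh : emb.IsRhombicTiling)
    (hbap : emb.HasBoundedAngles ε) (hε : 0 < ε) (hnb : ∀ v : V, ∃ u, G.Adj v u) {X : ℕ → ℂ}
    {w₀ : ℂ} {R : ℝ} (hX : ∀ n, ‖X n - w₀‖ ≤ R) :
    ∃ e : G.edgeSet, ∀ N, ∃ n, N ≤ n ∧ X n ∈ emb.rhombus e := by
  have hcov : ∀ n, ∃ e : G.edgeSet, X n ∈ emb.rhombus e := fun n => by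
    have : X n ∈ ⋃ e : G.edgeSet, emb.rhombus e := by rw [hrh.iUnion_rhombus]; trivial
    exact mem_iUnion.1 this
  choose e he using hcov
  set T : Set G.edgeSet := {e | ∃ X ∈ emb.rhombus e, ‖X - w₀‖ ≤ R}
  have hT : T.Finite := finite_setOf_rhombus_meets hiso hrh hbap hε hnb w₀ R
  have heT : ∀ n, e n ∈ T := fun n => ⟨X n, he n, hX n⟩
  haveI : Finite T := hT.to_subtype
  obtain ⟨⟨e₀, he₀⟩, hinf⟩ := Finite.exists_infinite_fiber (fun n : ℕ => (⟨e n, heT n⟩ : T))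
  refine ⟨e₀, fun N => ?_⟩
  have hinf' : ((fun n : ℕ => (⟨e n, heT n⟩ : T)) ⁻¹' {⟨e₀, he₀⟩}).Infinite :=
    Set.infinite_coe_iff.1 hinf
  obtain ⟨n, hn, hNn⟩ := hinf'.exists_gt N
  refine ⟨n, hNn.le, ?_⟩
  simp only [mem_preimage, mem_singleton_iff, Subtype.mk.injEq] at hn
  rw [← hn]; exact he n

/-- A rhombus is closed. [folklore] -/
theorem isClosed_rhombus (e : G.edgeSet) : IsClosed (emb.rhombus e) := by
  unfold RhombicEmbedding.rhombus
  exact (Set.toFinite _).isClosed_convexHull ℝ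

/-- A rhombus is convex. [folklore] -/
theorem convex_rhombus (e : G.edgeSet) : Convex ℝ (emb.rhombus e) := convex_convexHull ℝ _

/-- **A rhombus is the closure of its interior.** [folklore] -/
theorem rhombus_subset_closure_interior (hiso : emb.IsIsoradial) (e : G.edgeSet) :
    emb.rhombus e ⊆ closure (interior (emb.rhombus e)) := by
  set d := RhombicEmbedding.refDart e
  have hne : (interior (emb.rhombus e)).Nonempty := by
    rw [← edge_refDart e]
    obtain ⟨-, hAB, -⟩ := dart_quad hiso d
    have hmid : ((1/2 : ℝ) • emb.z d.fst + (1/2 : ℝ) • emb.z d.snd) ∈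
        openSegment ℝ (emb.z d.fst) (emb.z d.snd) :=
      ⟨1/2, 1/2, by norm_num, by norm_num, by norm_num, rfl⟩
    exact ⟨_, openSegment_z_subset_interior_rhombus hiso d hmid⟩
  rw [(convex_rhombus e).closure_interior_eq_closure_of_nonempty_interior hne]
  exact subset_closure

/-- **An open set meeting a rhombus meets its interior.** [folklore] -/
theorem exists_mem_interior_rhombus_of_isOpen (hiso : emb.IsIsoradial) {U : Set ℂ}
    (hU : IsOpen U) {e : G.edgeSet} {x : ℂ} (hxU : x ∈ U) (hxe : x ∈ emb.rhombus e) :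
    ∃ y ∈ U, y ∈ interior (emb.rhombus e) := by
  have hx := rhombus_subset_closure_interior hiso e hxe
  rw [_root_.mem_closure_iff] at hx
  obtain ⟨y, hyU, hy⟩ := hx U hU hxU
  exact ⟨y, hyU, hy⟩

/-- **An open subset of one rhombus meets no other rhombus** (disjoint interiors). [folklore] -/
theorem edge_eq_of_isOpen_subset_rhombus (hiso : emb.IsIsoradial) (hrh : emb.IsRhombicTiling)
    {U : Set ℂ} (hU : IsOpen U) {e e' : G.edgeSet} (hUe : U ⊆ emb.rhombus e) {x : ℂ}
    (hxU : x ∈ U) (hxe' : x ∈ emb.rhombus e') : e' = e := by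
  obtain ⟨y, hyU, hy'⟩ := exists_mem_interior_rhombus_of_isOpen hiso hU hxU hxe'
  have hy : y ∈ interior (emb.rhombus e) := interior_maximal hUe hU hyU
  by_contra hne
  exact Set.disjoint_left.1 (hrh.disjoint_interior hne) hy' hy

/-- The cross product against a fixed vector is continuous. [folklore] -/
theorem continuous_cross_right (u A : ℂ) : Continuous fun X : ℂ => cross u (X - A) := by
  unfold cross; fun_prop

/-- **The tile across a side.** A point `ρ` of the open side `(z d.fst, c (dartFace d b))` of the
rhombus of `d` lies in a second rhombus. [cite: GrimmettManolescu2014Isoradial, §4.1 (the diamond graph is a rhombic tiling)] -/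
theorem exists_rhombus_across (hiso : emb.IsIsoradial) (hrh : emb.IsRhombicTiling)
    (hbap : emb.HasBoundedAngles ε) (hε : 0 < ε) (hnb : ∀ v : V, ∃ u, G.Adj v u) (d : G.Dart)
    (b : Bool) {ρ : ℂ} (hρ : ρ ∈ openSegment ℝ (emb.z d.fst) (emb.c (emb.dartFace d b))) :
    ∃ e' : G.edgeSet, e' ≠ ⟨d.edge, d.edge_mem⟩ ∧ ρ ∈ emb.rhombus e' := by
  obtain ⟨hsum, hAB, hPQ, hAP, hBP⟩ := dart_quad' hiso d b
  set A := emb.z d.fst with hA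
  set P := emb.c (emb.dartFace d b) with hP
  set B := emb.z d.snd with hB
  set Q := emb.c (emb.dartFace d (!b)) with hQ
  set u : ℂ := P - A with hu
  set σ : ℝ := cross u (Q - A) with hσ
  have hc : σ ≠ 0 := cross_ne_zero_of_quad hsum hAB hPQ hAP hBP
  have hun : ‖u‖ = 1 := by rw [hu, norm_sub_rev, hAP]
  -- `ρ - A` is parallel to `u`
  have hρu : cross u (ρ - A) = 0 := by
    obtain ⟨a, b', -, -, hab, hρeq⟩ := hρ
    have hab' : (a : ℂ) + b' = 1 := by exact_mod_cast hab
    have : ρ - A = (b' : ℂ) * u := by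
      rw [← hρeq]; simp only [Complex.real_smul, hu]
      linear_combination (A : ℂ) * hab'
    rw [this, cross_ofReal_mul_right, cross_self, mul_zero]
  -- points just across the side
  set X : ℕ → ℂ := fun n => ρ - (((1 : ℝ) / (n + 1) * (σ / |σ|) : ℝ) : ℂ) * (I * u) with hX
  have hIu : cross u (I * u) = 1 := by
    rw [cross_apply]
    have : ‖u‖ ^ 2 = 1 := by rw [hun]; norm_num
    rw [Complex.sq_norm, Complex.normSq_apply] at this
    simp; nlinarith [this]
  have hXout : ∀ n, X n ∉ emb.rhombus ⟨d.edge, d.edge_mem⟩ := by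
    intro n hn
    rw [rhombus_eq_quad hiso d b] at hn
    have h := cross_mul_cross_nonneg_of_mem hsum hn
    have : cross u (X n - A) = -((1 : ℝ) / (n + 1) * (σ / |σ|)) := by
      have e1 : X n - A = (ρ - A) - (((1 : ℝ) / (n + 1) * (σ / |σ|) : ℝ) : ℂ) * (I * u) := by
        rw [hX]; ring
      rw [e1, cross_sub_right, hρu, cross_ofReal_mul_right, hIu, mul_one, zero_sub]
    rw [this] at h
    change 0 ≤ -((1 : ℝ) / (n + 1) * (σ / |σ|)) * σ at h
    have hσ2 : σ * σ = |σ| * |σ| := (abs_mul_abs_self σ).symm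
    have hapos : 0 < |σ| := abs_pos.2 hc
    have hn1 : (0 : ℝ) < 1 / (n + 1) := by positivity
    have : -((1 : ℝ) / (n + 1) * (σ / |σ|)) * σ = -(1 / (n + 1)) * |σ| := by
      field_simp; linarith [hσ2]
    rw [this] at h
    nlinarith
  have hXdist : ∀ n : ℕ, ‖X n - ρ‖ = 1 / (n + 1) := by
    intro n
    have hr : |(1 : ℝ) / (n + 1) * (σ / |σ|)| = 1 / (n + 1) := by
      rw [abs_mul, abs_div σ, abs_abs, div_self (abs_ne_zero.2 hc), mul_one,
        abs_of_pos (by positivity)]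
    have : X n - ρ = -((((1 : ℝ) / (n + 1) * (σ / |σ|) : ℝ) : ℂ) * (I * u)) := by rw [hX]; ring
    rw [this, norm_neg, norm_mul, norm_mul, Complex.norm_I, hun, Complex.norm_real,
      Real.norm_eq_abs, hr]; ring
  have hXbd : ∀ n, ‖X n - ρ‖ ≤ 1 := by
    intro n; rw [hXdist]
    rw [div_le_one (by positivity)]; linarith [(Nat.cast_nonneg n : (0:ℝ) ≤ n)]
  obtain ⟨e', he'⟩ := exists_rhombus_frequently hiso hrh hbap hε hnb hXbd
  refine ⟨e', ?_, ?_⟩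
  · rintro rfl
    obtain ⟨n, -, hn⟩ := he' 0
    exact hXout n hn
  · -- `ρ` is a limit of points of the closed set `rhombus e'`
    have : ρ ∈ closure (emb.rhombus e') := by
      rw [Metric.mem_closure_iff]
      intro δ hδ
      obtain ⟨N, hN⟩ := exists_nat_gt (1 / δ)
      obtain ⟨n, hNn, hn⟩ := he' N
      refine ⟨X n, hn, ?_⟩
      rw [dist_comm, dist_eq_norm, hXdist]
      rw [div_lt_iff₀ (by positivity)]
      have hN' : 1 / δ < (n : ℝ) + 1 := by
        have : (N : ℝ) ≤ n := by exact_mod_cast hNn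
        linarith
      calc (1 : ℝ) = 1 / δ * δ := by field_simp
        _ < (n + 1) * δ := mul_lt_mul_of_pos_right hN' hδ
        _ = δ * (n + 1) := by ring
    exact (isClosed_rhombus e').closure_subset this

/-- **The tile across stays across.** If a second rhombus `e' ≠ e(d)` contains points near a
point `ρ` of the open side `(A, P)` of the rhombus of `d`, then near `ρ` it lies in the closed
half-plane of the line `AP` *not* containing the rhombus of `d`. [folklore] -/
theorem cross_nonpos_of_mem_rhombus_across (hiso : emb.IsIsoradial) (hrh : emb.IsRhombicTiling)
    (d : G.Dart) (b : Bool) {ρ : ℂ}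
    (hρ : ρ ∈ openSegment ℝ (emb.z d.fst) (emb.c (emb.dartFace d b))) {e' : G.edgeSet}
    (he' : e' ≠ ⟨d.edge, d.edge_mem⟩) :
    ∃ δ > 0, ∀ Y ∈ emb.rhombus e', dist Y ρ < δ →
      cross (emb.c (emb.dartFace d b) - emb.z d.fst) (Y - emb.z d.fst) *
        cross (emb.c (emb.dartFace d b) - emb.z d.fst) (emb.c (emb.dartFace d (!b)) - emb.z d.fst)
          ≤ 0 := by
  obtain ⟨hsum, hAB, hPQ, hAP, hBP⟩ := dart_quad' hiso d b
  obtain ⟨δ, hδ, hhalf⟩ := exists_ball_inter_halfPlane_subset_quad hsum hAB hPQ hAP hBP hρ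
  refine ⟨δ, hδ, fun Y hY hYρ => le_of_not_gt fun hpos => ?_⟩
  set u := emb.c (emb.dartFace d b) - emb.z d.fst
  set σ := cross u (emb.c (emb.dartFace d (!b)) - emb.z d.fst)
  set U : Set ℂ := ball ρ δ ∩ {X | 0 < cross u (X - emb.z d.fst) * σ} with hU
  have hUo : IsOpen U :=
    isOpen_ball.inter (isOpen_lt continuous_const ((continuous_cross_right u _).mul continuous_const))
  have hUsub : U ⊆ emb.rhombus ⟨d.edge, d.edge_mem⟩ := by
    rintro X ⟨hXb, hXs⟩
    rw [rhombus_eq_quad hiso d b]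
    exact hhalf X (mem_ball.1 hXb) (le_of_lt hXs)
  exact he' (edge_eq_of_isOpen_subset_rhombus hiso hrh hUo hUsub ⟨mem_ball.2 hYρ, hpos⟩ hY)

/-! ### §3 No T-junctions: the tiling is edge-to-edge -/

/-- Coordinates on an open segment. [folklore] -/
theorem exists_coord_of_mem_openSegment {A P ρ : ℂ} (h : ρ ∈ openSegment ℝ A P) :
    ∃ θ : ℝ, 0 < θ ∧ θ < 1 ∧ ρ = A + (θ : ℂ) * (P - A) := by
  obtain ⟨a, θ, ha, hθ, haθ, rfl⟩ := h
  have haθ' : (a : ℂ) + θ = 1 := by exact_mod_cast haθ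
  refine ⟨θ, hθ, by linarith, ?_⟩
  simp only [Complex.real_smul]
  linear_combination (A : ℂ) * haθ'

/-- Coordinates on a closed segment. [folklore] -/
theorem exists_coord_of_mem_segment {A P ρ : ℂ} (h : ρ ∈ segment ℝ A P) :
    ∃ θ : ℝ, 0 ≤ θ ∧ θ ≤ 1 ∧ ρ = A + (θ : ℂ) * (P - A) := by
  obtain ⟨a, θ, ha, hθ, haθ, rfl⟩ := h
  have haθ' : (a : ℂ) + θ = 1 := by exact_mod_cast haθ
  refine ⟨θ, hθ, by linarith, ?_⟩
  simp only [Complex.real_smul]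
  linear_combination (A : ℂ) * haθ'

/-- A point with coordinate in `(0, 1)` lies on the open segment. [folklore] -/
theorem mem_openSegment_of_coord (A P : ℂ) {θ : ℝ} (h0 : 0 < θ) (h1 : θ < 1) :
    A + (θ : ℂ) * (P - A) ∈ openSegment ℝ A P :=
  ⟨1 - θ, θ, by linarith, h0, by ring, by simp only [Complex.real_smul]; push_cast; ring⟩

/-- A standard side lies in its rhombus. [folklore] -/
theorem segment_subset_rhombus (hiso : emb.IsIsoradial) (d : G.Dart) (b : Bool) :
    segment ℝ (emb.z d.fst) (emb.c (emb.dartFace d b)) ⊆ emb.rhombus ⟨d.edge, d.edge_mem⟩ := by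
  rw [rhombus_eq_quad hiso d b]
  exact segment_subset_convexHull (by simp) (by simp)

/-- **Every boundary point of a rhombus lies on a standard side** `[z d₁.fst, c (dartFace d₁ b₁)]`
of one of the darts `d₁ ∈ {d, d.symm}` over the same edge. [folklore] -/
theorem exists_std_side_of_not_mem_interior (hiso : emb.IsIsoradial) (d : G.Dart) {X : ℂ}
    (hX : X ∈ emb.rhombus ⟨d.edge, d.edge_mem⟩)
    (hXi : X ∉ interior (emb.rhombus ⟨d.edge, d.edge_mem⟩)) :
    ∃ (d₁ : G.Dart) (b₁ : Bool), d₁.edge = d.edge ∧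
      X ∈ segment ℝ (emb.z d₁.fst) (emb.c (emb.dartFace d₁ b₁)) := by
  obtain ⟨hsum, hAB, hPQ, hAP, hBP⟩ := dart_quad' hiso d true
  rw [rhombus_eq_quad hiso d true] at hX hXi
  rcases mem_sides_of_not_mem_interior hsum hAB hPQ hAP hBP hX hXi with h | h | h | h
  · exact ⟨d, true, rfl, h⟩
  · refine ⟨d.symm, false, d.edge_symm, ?_⟩
    rw [dartFace_symm hiso, segment_symm]; simpa using h
  · refine ⟨d.symm, true, d.edge_symm, ?_⟩
    rw [dartFace_symm hiso]; simpa using h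
  · refine ⟨d, false, rfl, ?_⟩
    rw [segment_symm]; simpa using h

/-- **No T-junctions**: no corner of a rhombus lies in the open side of a rhombus. (A property
of genuine rhombic tilings — Grimmett–Manolescu 2014, §4.1: the tiles of `G^◇` meet along full
sides; it fails for the loose predicate `IsRhombicTiling` alone, e.g. rows of squares shifted by
half a unit, and follows from `G.Preconnected`, part III.) [cite: GrimmettManolescu2014Isoradial, §4.1 (the diamond graph is a rhombic tiling)] -/
def _root_.Literature.Probability.LatticeModels.RhombicEmbedding.NoTJunction
    (emb : RhombicEmbedding G F) : Prop :=
  ∀ (d d' : G.Dart) (b : Bool) (q : ℂ),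
    q ∈ ({emb.z d'.fst, emb.z d'.snd, emb.c (emb.leftFace d'), emb.c (emb.rightFace d')} : Set ℂ) →
      q ∉ openSegment ℝ (emb.z d.fst) (emb.c (emb.dartFace d b))

/-- No T-junction at the tail of a dart. [folklore] -/
theorem _root_.Literature.Probability.LatticeModels.RhombicEmbedding.NoTJunction.z_fst
    (hT : emb.NoTJunction) (d d' : G.Dart) (b : Bool) :
    emb.z d'.fst ∉ openSegment ℝ (emb.z d.fst) (emb.c (emb.dartFace d b)) :=
  hT d d' b _ (by simp)

/-- No T-junction at the head of a dart. [folklore] -/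
theorem _root_.Literature.Probability.LatticeModels.RhombicEmbedding.NoTJunction.z_snd
    (hT : emb.NoTJunction) (d d' : G.Dart) (b : Bool) :
    emb.z d'.snd ∉ openSegment ℝ (emb.z d.fst) (emb.c (emb.dartFace d b)) :=
  hT d d' b _ (by simp)

/-- No T-junction at a face centre. [folklore] -/
theorem _root_.Literature.Probability.LatticeModels.RhombicEmbedding.NoTJunction.c_dartFace
    (hT : emb.NoTJunction) (d d' : G.Dart) (b b' : Bool) :
    emb.c (emb.dartFace d' b') ∉ openSegment ℝ (emb.z d.fst) (emb.c (emb.dartFace d b)) :=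
  hT d d' b _ (by cases b' <;> simp)

/-- Two positive multiples of parallel unit vectors: if `u' = λ u` with `‖u‖ = ‖u'‖ = 1` then
`λ = 1 ∨ λ = -1`. [folklore] -/
theorem dot_eq_one_or_neg_one {u u' : ℂ} (hu : ‖u‖ = 1) (hu' : ‖u'‖ = 1) (h : cross u u' = 0) :
    (u' = u ∨ u' = -u) := by
  have hq := eq_dot_mul_of_cross_eq_zero hu h
  have hl : |dot u u'| = 1 := by
    have := congrArg norm hq
    rw [hu', norm_mul, Complex.norm_real, hu, mul_one, Real.norm_eq_abs] at this
    exact this.symm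
  rcases (abs_eq zero_le_one).1 hl with h1 | h1
  · left; rw [hq, h1]; push_cast; ring
  · right; rw [hq, h1]; push_cast; ring

/-- **Edge-to-edge.** Under `NoTJunction`, a point `ρ` of the open side `(A, P)`,
`A = z d.fst`, `P = c (dartFace d b)`, of the rhombus of `d` lies in the rhombus of a dart `d'`
over a *different* edge which has a standard side with the same endpoints `{A, P}` and which
lies across the line `AP`: with `Q' = c (dartFace d' (!b'))`, the cross products
`(P - A) × (Q' - z d'.fst)` and `(P - A) × (Q - A)` have opposite signs.
[cite: GrimmettManolescu2014Isoradial, §4.1 (the diamond graph is a rhombic tiling)] -/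
theorem exists_dart_across (hiso : emb.IsIsoradial) (hrh : emb.IsRhombicTiling)
    (hbap : emb.HasBoundedAngles ε) (hε : 0 < ε) (hnb : ∀ v : V, ∃ u, G.Adj v u)
    (hT : emb.NoTJunction) (d : G.Dart) (b : Bool) {ρ : ℂ}
    (hρ : ρ ∈ openSegment ℝ (emb.z d.fst) (emb.c (emb.dartFace d b))) :
    ∃ (d' : G.Dart) (b' : Bool), d'.edge ≠ d.edge ∧ ρ ∈ emb.rhombus ⟨d'.edge, d'.edge_mem⟩ ∧
      ((emb.z d'.fst = emb.z d.fst ∧ emb.c (emb.dartFace d' b') = emb.c (emb.dartFace d b)) ∨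
        (emb.z d'.fst = emb.c (emb.dartFace d b) ∧ emb.c (emb.dartFace d' b') = emb.z d.fst)) ∧
      cross (emb.c (emb.dartFace d b) - emb.z d.fst) (emb.c (emb.dartFace d' (!b')) - emb.z d'.fst) *
        cross (emb.c (emb.dartFace d b) - emb.z d.fst) (emb.c (emb.dartFace d (!b)) - emb.z d.fst)
          < 0 := by
  obtain ⟨hsum, hAB, hPQ, hAP, hBP⟩ := dart_quad' hiso d b
  set A := emb.z d.fst with hA
  set P := emb.c (emb.dartFace d b) with hP
  set B := emb.z d.snd with hB
  set Q := emb.c (emb.dartFace d (!b)) with hQ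
  set u : ℂ := P - A with hu
  set σ : ℝ := cross u (Q - A) with hσ
  have hc : σ ≠ 0 := cross_ne_zero_of_quad hsum hAB hPQ hAP hBP
  have hun : ‖u‖ = 1 := by rw [hu, norm_sub_rev, hAP]
  obtain ⟨β, hβ0, hβ1, hρβ⟩ := exists_coord_of_mem_openSegment hρ
  have hρu : cross u (ρ - A) = 0 := by
    rw [hρβ, add_sub_cancel_left, cross_ofReal_mul_right, cross_self, mul_zero]
  -- the second rhombus
  obtain ⟨e', hne, hρe'⟩ := exists_rhombus_across hiso hrh hbap hε hnb d b hρ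
  set d₀ := RhombicEmbedding.refDart e' with hd₀
  have he' : (⟨d₀.edge, d₀.edge_mem⟩ : G.edgeSet) = e' := edge_refDart e'
  rw [← he'] at hne hρe'
  have hρd : ρ ∈ emb.rhombus ⟨d.edge, d.edge_mem⟩ :=
    segment_subset_rhombus hiso d b (openSegment_subset_segment ℝ _ _ hρ)
  have hρi : ρ ∉ interior (emb.rhombus ⟨d₀.edge, d₀.edge_mem⟩) := fun h =>
    hne (edge_eq_of_isOpen_subset_rhombus hiso hrh isOpen_interior interior_subset h hρd).symm
  obtain ⟨d', b', hd'e, hρs⟩ := exists_std_side_of_not_mem_interior hiso d₀ hρe' hρi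
  have hne' : d'.edge ≠ d.edge := by
    intro h; apply hne; exact Subtype.ext (hd'e.symm.trans h)
  have hρe'' : ρ ∈ emb.rhombus ⟨d'.edge, d'.edge_mem⟩ := by
    rw [show (⟨d'.edge, d'.edge_mem⟩ : G.edgeSet) = ⟨d₀.edge, d₀.edge_mem⟩ from Subtype.ext hd'e]
    exact hρe'
  -- data of `d'`
  obtain ⟨hsum', hAB', hPQ', hAP', hBP'⟩ := dart_quad' hiso d' b'
  set A' := emb.z d'.fst with hA'
  set P' := emb.c (emb.dartFace d' b') with hP'
  set B' := emb.z d'.snd with hB'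
  set Q' := emb.c (emb.dartFace d' (!b')) with hQ'
  set u' : ℂ := P' - A' with hu'
  set σ' : ℝ := cross u' (Q' - A') with hσ'
  have hc' : σ' ≠ 0 := cross_ne_zero_of_quad hsum' hAB' hPQ' hAP' hBP'
  have hun' : ‖u'‖ = 1 := by rw [hu', norm_sub_rev, hAP']
  have hwn' : ‖Q' - A'‖ = 1 := by
    have : Q' - A' = B' - P' := by linear_combination hsum'
    rw [this, hBP']
  -- `ρ` is in the open side of `d'` (no T-junction)
  have hρ' : ρ ∈ openSegment ℝ A' P' := by
    rcases Mesh.eq_or_eq_or_mem_openSegment hρs with h | h | h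
    · have h1 := hT.z_fst d d' b
      rw [show emb.z d'.fst = ρ from h.symm] at h1
      exact absurd hρ h1
    · have h1 := hT.c_dartFace d d' b b'
      rw [show emb.c (emb.dartFace d' b') = ρ from h.symm] at h1
      exact absurd hρ h1
    · exact h
  obtain ⟨β', hβ0', hβ1', hρβ'⟩ := exists_coord_of_mem_openSegment hρ'
  have hρu' : cross u' (ρ - A') = 0 := by
    rw [hρβ', add_sub_cancel_left, cross_ofReal_mul_right, cross_self, mul_zero]
  -- the two local descriptions near `ρ`
  obtain ⟨δ', hδ', hhalf'⟩ := exists_ball_inter_halfPlane_subset_quad hsum' hAB' hPQ' hAP' hBP' hρ'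
  have hne2 : (⟨d'.edge, d'.edge_mem⟩ : G.edgeSet) ≠ ⟨d.edge, d.edge_mem⟩ :=
    fun h => hne' (congrArg Subtype.val h)
  obtain ⟨δ₁, hδ₁, hacross⟩ := cross_nonpos_of_mem_rhombus_across hiso hrh d b hρ hne2
  have hmemd' : ∀ Y, Y ∈ convexHull ℝ ({A', P', B', Q'} : Set ℂ) →
      Y ∈ emb.rhombus ⟨d'.edge, d'.edge_mem⟩ := by
    intro Y hY; rw [rhombus_eq_quad hiso d' b']; exact hY
  -- Step 1: the two sides are parallel
  have hpar : cross u u' = 0 := by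
    by_contra hx
    set η : ℝ := min δ' δ₁ / 2 with hη
    have hηpos : 0 < η := by positivity
    have hηδ' : η < δ' := by
      have := min_le_left δ' δ₁; rw [hη]; linarith
    have hηδ₁ : η < δ₁ := by
      have := min_le_right δ' δ₁; rw [hη]; linarith
    have key : ∀ s : ℝ, |s| = η → s * cross u u' * σ ≤ 0 := by
      intro s hs
      set Y : ℂ := ρ + (s : ℂ) * u' with hY
      have hYdist : dist Y ρ = η := by
        rw [dist_eq_norm, hY, add_sub_cancel_left, norm_mul, Complex.norm_real, hun', mul_one,
          Real.norm_eq_abs, hs]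
      have hYin : Y ∈ convexHull ℝ ({A', P', B', Q'} : Set ℂ) := by
        refine hhalf' Y (by rw [hYdist]; exact hηδ') ?_
        have : cross u' (Y - A') = 0 := by
          have e1 : Y - A' = (ρ - A') + (s : ℂ) * u' := by rw [hY]; ring
          rw [e1, cross_add_right, hρu', cross_ofReal_mul_right, cross_self, mul_zero, add_zero]
        rw [this, zero_mul]
      have h1 := hacross Y (hmemd' Y hYin) (by rw [hYdist]; exact hηδ₁)
      have e2 : cross u (Y - A) = s * cross u u' := by
        have e1 : Y - A = (ρ - A) + (s : ℂ) * u' := by rw [hY]; ring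
        rw [e1, cross_add_right, hρu, cross_ofReal_mul_right, zero_add]
      rw [e2] at h1
      exact h1
    have k1 := key η (abs_of_pos hηpos)
    have k2 := key (-η) (by rw [abs_neg, abs_of_pos hηpos])
    have : η * (cross u u' * σ) = 0 := by nlinarith
    rcases mul_eq_zero.1 this with h | h
    · exact hηpos.ne' h
    · rcases mul_eq_zero.1 h with h | h
      · exact hx h
      · exact hc h
  -- Step 2: the sides coincide as sets of endpoints
  have hends : (A' = A ∧ P' = P) ∨ (A' = P ∧ P' = A) := by
    have hA'nm : A' ∉ openSegment ℝ A P := hT.z_fst d d' b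
    have hP'nm : P' ∉ openSegment ℝ A P := hT.c_dartFace d d' b b'
    have hAnm : A ∉ openSegment ℝ A' P' := hT.z_fst d' d b'
    have hPnm : P ∉ openSegment ℝ A' P' := hT.c_dartFace d' d b' b
    rcases dot_eq_one_or_neg_one hun hun' hpar with hl | hl
    · -- `u' = u`
      left
      have hA'eq : A' = A + ((β - β' : ℝ) : ℂ) * (P - A) := by
        have : A' = ρ - (β' : ℂ) * u' := by rw [hρβ']; ring
        rw [this, hρβ, hl]; push_cast; ring
      have hAeq : A = A' + ((β' - β : ℝ) : ℂ) * (P' - A') := by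
        have : A = ρ - (β : ℂ) * u := by rw [hρβ]; ring
        rw [this, hρβ', ← hu', hl]; push_cast; ring
      have h1 : ¬ (0 < β - β') := fun h =>
        hA'nm (hA'eq ▸ mem_openSegment_of_coord A P h (by linarith))
      have h2 : ¬ (0 < β' - β) := fun h =>
        hAnm (hAeq ▸ mem_openSegment_of_coord A' P' h (by linarith))
      have hββ : β = β' := by have := not_lt.1 h1; have := not_lt.1 h2; linarith
      have hAA : A' = A := by rw [hA'eq, hββ]; push_cast; ring
      refine ⟨hAA, ?_⟩
      have : P' = A' + u' := by rw [hu']; ring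
      rw [this, hAA, hl, hu]; ring
    · -- `u' = -u`
      right
      have hA'eq : A' = A + ((β + β' : ℝ) : ℂ) * (P - A) := by
        have : A' = ρ - (β' : ℂ) * u' := by rw [hρβ']; ring
        rw [this, hρβ, hl]; push_cast; ring
      have hP'eq : P' = A + ((β + β' - 1 : ℝ) : ℂ) * (P - A) := by
        have : P' = A' + u' := by rw [hu']; ring
        rw [this, hA'eq, hl, hu]; push_cast; ring
      have h1 : ¬ (β + β' < 1) := fun h =>
        hA'nm (hA'eq ▸ mem_openSegment_of_coord A P (by linarith) h)
      have h2 : ¬ (0 < β + β' - 1) := fun h =>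
        hP'nm (hP'eq ▸ mem_openSegment_of_coord A P h (by linarith))
      have hββ : β + β' = 1 := by have := not_lt.1 h1; have := not_lt.1 h2; linarith
      constructor
      · rw [hA'eq, hββ]; push_cast; ring
      · rw [hP'eq, hββ]; push_cast; ring
  -- Step 3: the second rhombus lies across
  have hfar : cross u (Q' - A') * σ < 0 := by
    set η : ℝ := min δ₁ 1 / 2 with hη
    have hηpos : 0 < η := by positivity
    have hηδ₁ : η < δ₁ := by have := min_le_left δ₁ 1; rw [hη]; linarith
    have hη1 : η ≤ 1 := by have := min_le_right δ₁ 1; rw [hη]; linarith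
    set Y : ℂ := ρ + (η : ℂ) * (Q' - A') with hY
    have hYdist : dist Y ρ = η := by
      rw [dist_eq_norm, hY, add_sub_cancel_left, norm_mul, Complex.norm_real, hwn', mul_one,
        Real.norm_eq_abs, abs_of_pos hηpos]
    have hYin : Y ∈ convexHull ℝ ({A', P', B', Q'} : Set ℂ) := by
      rw [mem_convexHull_quad_iff hsum']
      refine ⟨β', ⟨hβ0'.le, hβ1'.le⟩, η, ⟨hηpos.le, hη1⟩, ?_⟩
      rw [hY, hρβ']
    have h1 := hacross Y (hmemd' Y hYin) (by rw [hYdist]; exact hηδ₁)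
    have e2 : cross u (Y - A) = η * cross u (Q' - A') := by
      have e1 : Y - A = (ρ - A) + (η : ℂ) * (Q' - A') := by rw [hY]; ring
      rw [e1, cross_add_right, hρu, cross_ofReal_mul_right, zero_add]
    rw [e2] at h1
    have hle : cross u (Q' - A') * σ ≤ 0 := by
      have : η * (cross u (Q' - A') * σ) ≤ 0 := by linarith [h1, mul_assoc η (cross u (Q' - A')) σ]
      nlinarith
    refine lt_of_le_of_ne hle fun h0 => ?_
    rcases mul_eq_zero.1 h0 with h | h
    · -- `Q' - A'` parallel to `u`, hence to `u'`: degenerate rhombus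
      apply hc'
      rcases dot_eq_one_or_neg_one hun hun' hpar with hl | hl
      · rw [hσ', hl]; exact h
      · rw [hσ', hl, cross_neg_left, h, neg_zero]
    · exact hc h
  exact ⟨d', b', hne', hρe'', by
    rcases hends with ⟨h1, h2⟩ | ⟨h1, h2⟩
    · exact Or.inl ⟨h1, h2⟩
    · exact Or.inr ⟨h1, h2⟩, hfar⟩

/-- **The two rhombi at a side cover a neighbourhood of each point of the open side.**
[folklore] -/
theorem ball_subset_union_of_across (hiso : emb.IsIsoradial) (d : G.Dart) (b : Bool) {ρ : ℂ}
    (hρ : ρ ∈ openSegment ℝ (emb.z d.fst) (emb.c (emb.dartFace d b))) (d' : G.Dart) (b' : Bool)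
    (hends : (emb.z d'.fst = emb.z d.fst ∧ emb.c (emb.dartFace d' b') = emb.c (emb.dartFace d b)) ∨
      (emb.z d'.fst = emb.c (emb.dartFace d b) ∧ emb.c (emb.dartFace d' b') = emb.z d.fst))
    (hfar : cross (emb.c (emb.dartFace d b) - emb.z d.fst)
        (emb.c (emb.dartFace d' (!b')) - emb.z d'.fst) *
      cross (emb.c (emb.dartFace d b) - emb.z d.fst) (emb.c (emb.dartFace d (!b)) - emb.z d.fst) < 0) :
    ∃ δ > 0, ball ρ δ ⊆ emb.rhombus ⟨d.edge, d.edge_mem⟩ ∪ emb.rhombus ⟨d'.edge, d'.edge_mem⟩ := by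
  obtain ⟨hsum, hAB, hPQ, hAP, hBP⟩ := dart_quad' hiso d b
  obtain ⟨hsum', hAB', hPQ', hAP', hBP'⟩ := dart_quad' hiso d' b'
  set A := emb.z d.fst with hA
  set P := emb.c (emb.dartFace d b) with hP
  set Q := emb.c (emb.dartFace d (!b)) with hQ
  set A' := emb.z d'.fst with hA'
  set P' := emb.c (emb.dartFace d' b') with hP'
  set Q' := emb.c (emb.dartFace d' (!b')) with hQ'
  set u : ℂ := P - A with hu
  set σ : ℝ := cross u (Q - A) with hσ
  have hρ' : ρ ∈ openSegment ℝ A' P' := by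
    rcases hends with ⟨h1, h2⟩ | ⟨h1, h2⟩
    · rw [h1, h2]; exact hρ
    · rw [h1, h2, openSegment_symm]; exact hρ
  obtain ⟨δ₁, hδ₁, h₁⟩ := exists_ball_inter_halfPlane_subset_quad hsum hAB hPQ hAP hBP hρ
  obtain ⟨δ₂, hδ₂, h₂⟩ := exists_ball_inter_halfPlane_subset_quad hsum' hAB' hPQ' hAP' hBP' hρ'
  refine ⟨min δ₁ δ₂, lt_min hδ₁ hδ₂, fun X hX => ?_⟩
  rw [mem_ball] at hX
  rcases le_or_gt 0 (cross u (X - A) * σ) with hs | hs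
  · left
    rw [rhombus_eq_quad hiso d b]
    exact h₁ X (lt_of_lt_of_le hX (min_le_left _ _)) hs
  · right
    rw [rhombus_eq_quad hiso d' b']
    refine h₂ X (lt_of_lt_of_le hX (min_le_right _ _)) ?_
    -- the half-plane condition of `d'` is the complementary one
    have key : cross (P' - A') (X - A') * cross (P' - A') (Q' - A') =
        cross u (X - A) * cross u (Q' - A') := by
      rcases hends with ⟨h1, h2⟩ | ⟨h1, h2⟩
      · rw [h1, h2]
      · rw [h1, h2]
        have e1 : A - P = -u := by rw [hu]; ring
        have e2 : X - P = (X - A) - u := by rw [hu]; ring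
        rw [e1, e2, cross_neg_left, cross_neg_left, cross_sub_right, cross_self, sub_zero]
        ring
    rw [key]
    have hσ2 : 0 < σ * σ := mul_self_pos.2 (cross_ne_zero_of_quad hsum hAB hPQ hAP hBP)
    nlinarith [hfar, hs]

/-- **Only the two rhombi at a side contain a point of the open side.** [folklore] -/
theorem edge_eq_or_eq_of_mem_rhombus (hiso : emb.IsIsoradial) (hrh : emb.IsRhombicTiling)
    {ρ : ℂ} {δ : ℝ} {e e' e'' : G.edgeSet} (hδ : 0 < δ)
    (hcov : ball ρ δ ⊆ emb.rhombus e ∪ emb.rhombus e') (hρ : ρ ∈ emb.rhombus e'') :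
    e'' = e ∨ e'' = e' := by
  obtain ⟨y, hyb, hy⟩ := exists_mem_interior_rhombus_of_isOpen hiso isOpen_ball (mem_ball_self hδ) hρ
  rcases hcov hyb with h | h
  · obtain ⟨y', hy'1, hy'2⟩ := exists_mem_interior_rhombus_of_isOpen hiso isOpen_interior hy h
    left; by_contra hne
    exact Set.disjoint_left.1 (hrh.disjoint_interior hne) hy'1 hy'2
  · obtain ⟨y', hy'1, hy'2⟩ := exists_mem_interior_rhombus_of_isOpen hiso isOpen_interior hy h
    right; by_contra hne
    exact Set.disjoint_left.1 (hrh.disjoint_interior hne) hy'1 hy'2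

end Emb

/-! ### §4 Polygonal paths and their crossing defects -/

section Paths

/-- The end point of the polygonal path from `a` through the points of `l`. [folklore] -/
def chainEnd : ℂ → List ℂ → ℂ
  | a, [] => a
  | _, b :: l => chainEnd b l

/-- The consecutive pairs (pieces) of the polygonal path from `a` through `l`. [folklore] -/
def pieces : ℂ → List ℂ → List (ℂ × ℂ)
  | _, [] => []
  | a, b :: l => (a, b) :: pieces b l

/-- **The polygonal path** from `a` through the points of `l`, as a `Path`. [folklore] -/
def sidePath : (a : ℂ) → (l : List ℂ) → Path a (chainEnd a l)
  | a, [] => Path.refl a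
  | a, b :: l => (Path.segment a b).trans (sidePath b l)

/-- The end of the empty chain. [folklore] -/
@[simp] theorem chainEnd_nil (a : ℂ) : chainEnd a [] = a := rfl
/-- The end of a chain with a first step. [folklore] -/
@[simp] theorem chainEnd_cons (a b : ℂ) (l : List ℂ) : chainEnd a (b :: l) = chainEnd b l := rfl
/-- The empty chain has no pieces. [folklore] -/
@[simp] theorem pieces_nil (a : ℂ) : pieces a [] = [] := rfl
/-- The pieces of a chain with a first step. [folklore] -/
@[simp] theorem pieces_cons (a b : ℂ) (l : List ℂ) : pieces a (b :: l) = (a, b) :: pieces b l := rfl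
/-- The polygonal path of the empty chain is constant. [folklore] -/
theorem sidePath_nil (a : ℂ) : sidePath a [] = Path.refl a := rfl
/-- The polygonal path of a chain with a first step. [folklore] -/
theorem sidePath_cons (a b : ℂ) (l : List ℂ) :
    sidePath a (b :: l) = (Path.segment a b).trans (sidePath b l) := rfl

/-- A chain has as many pieces as points. [folklore] -/
@[simp] theorem length_pieces (a : ℂ) (l : List ℂ) : (pieces a l).length = l.length := by
  induction l generalizing a with
  | nil => rfl
  | cons b l ih => simp [ih]

/-- The end of a concatenated chain. [folklore] -/
theorem chainEnd_append (a : ℂ) (l l' : List ℂ) :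
    chainEnd a (l ++ l') = chainEnd (chainEnd a l) l' := by
  induction l generalizing a with
  | nil => rfl
  | cons b l ih => simp [ih]

/-- The pieces of a concatenated chain. [folklore] -/
theorem pieces_append (a : ℂ) (l l' : List ℂ) :
    pieces a (l ++ l') = pieces a l ++ pieces (chainEnd a l) l' := by
  induction l generalizing a with
  | nil => rfl
  | cons b l ih => simp [ih]

/-- The entries of the pieces are points of the chain. [folklore] -/
theorem mem_of_mem_pieces {a : ℂ} {l : List ℂ} {p : ℂ × ℂ} (hp : p ∈ pieces a l) :
    p.1 ∈ a :: l ∧ p.2 ∈ a :: l := by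
  induction l generalizing a with
  | nil => simp at hp
  | cons b l ih =>
    simp only [pieces_cons, List.mem_cons] at hp
    rcases hp with rfl | hp
    · simp
    · have := ih hp
      simp only [List.mem_cons] at this ⊢
      tauto

/-- **The range of the polygonal path** is the union of its pieces (or `{a}`). [folklore] -/
theorem mem_range_sidePath {a : ℂ} {l : List ℂ} {x : ℂ} (hx : x ∈ range (sidePath a l)) :
    x = a ∨ ∃ p ∈ pieces a l, x ∈ segment ℝ p.1 p.2 := by
  induction l generalizing a with
  | nil =>
    left
    change x ∈ range (Path.refl a) at hx
    rw [Path.refl_range] at hx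
    exact mem_singleton_iff.1 hx
  | cons b l ih =>
    change x ∈ range ((Path.segment a b).trans (sidePath b l)) at hx
    rw [Path.trans_range, Path.range_segment] at hx
    rcases hx with hx | hx
    · exact Or.inr ⟨(a, b), by simp, hx⟩
    · rcases ih hx with rfl | ⟨p, hp, hxp⟩
      · exact Or.inr ⟨(a, x), by simp, right_mem_segment _ _ _⟩
      · exact Or.inr ⟨p, by simp [hp], hxp⟩

/-- A point off all pieces is off the path. [folklore] -/
theorem not_mem_range_sidePath {a : ℂ} {l : List ℂ} {x : ℂ} (hxa : x ≠ a)
    (hx : ∀ p ∈ pieces a l, x ∉ segment ℝ p.1 p.2) : x ∉ range (sidePath a l) := fun h => by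
  rcases mem_range_sidePath h with h | ⟨p, hp, hxp⟩
  · exact hxa h
  · exact hx p hp hxp

/-- **The polygonal path stays in any closed disc containing its points.** [folklore] -/
theorem dist_sidePath_le {a : ℂ} {l : List ℂ} {c : ℂ} {R : ℝ} (h : ∀ x ∈ a :: l, dist x c ≤ R)
    (t : unitInterval) : dist (sidePath a l t) c ≤ R := by
  have hx : sidePath a l t ∈ range (sidePath a l) := mem_range_self t
  rcases mem_range_sidePath hx with h' | ⟨p, hp, hxp⟩
  · rw [h']; exact h a (by simp)
  · obtain ⟨h1, h2⟩ := mem_of_mem_pieces hp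
    have hsub : segment ℝ p.1 p.2 ⊆ closedBall c R :=
      (convex_closedBall c R).segment_subset (mem_closedBall.2 (h _ h1)) (mem_closedBall.2 (h _ h2))
    exact mem_closedBall.1 (hsub hxp)

/-- **Additivity of the crossing defect along a polygonal path.** [folklore] -/
theorem crossInc_sidePath {ℓ r : ℂ} {a : ℂ} {l : List ℂ} (hℓa : ℓ ≠ a) (hra : r ≠ a)
    (h : ∀ p ∈ pieces a l, ℓ ∉ segment ℝ p.1 p.2 ∧ r ∉ segment ℝ p.1 p.2) :
    (sidePath a l).crossInc ℓ r =
      ((pieces a l).map fun p => (Path.segment p.1 p.2).crossInc ℓ r).sum := by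
  induction l generalizing a with
  | nil => simp [sidePath_nil, Path.crossInc_refl]
  | cons b l ih =>
    rw [pieces_cons, List.map_cons, List.sum_cons]
    change ((Path.segment a b).trans (sidePath b l)).crossInc ℓ r = _
    have hab := h (a, b) (by simp)
    have hl' : ∀ p ∈ pieces b l, ℓ ∉ segment ℝ p.1 p.2 ∧ r ∉ segment ℝ p.1 p.2 :=
      fun p hp => h p (by simp [hp])
    have hℓb : ℓ ≠ b := fun h' => hab.1 (h' ▸ right_mem_segment _ _ _)
    have hrb : r ≠ b := fun h' => hab.2 (h' ▸ right_mem_segment _ _ _)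
    rw [Path.crossInc_trans]
    · rw [ih hℓb hrb hl']
    · rw [Path.range_segment]; exact hab.1
    · exact not_mem_range_sidePath hℓb fun p hp => (hl' p hp).1
    · rw [Path.range_segment]; exact hab.2
    · exact not_mem_range_sidePath hrb fun p hp => (hl' p hp).2

/-- **The crossing defects of the pieces against a test segment crossed by one side only.**
If the test segment `[ℓ, r]` separates `A` from `P` and crosses `[A, P]`, and every piece other
than `[A, P]`, `[P, A]` avoids `[ℓ, r]`, then the sum of the crossing defects of the pieces is
`2πi (N(A,P) - N(P,A))`. [folklore] -/
theorem sum_crossInc_pieces {A P ℓ r : ℂ} {ps : List (ℂ × ℂ)}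
    (hA : 0 < segSide ℓ r A) (hP : segSide ℓ r P < 0)
    (hx : ∃ q ∈ segment ℝ A P, q ∈ openSegment ℝ ℓ r)
    (havoid : ∀ p ∈ ps, p ≠ (A, P) → p ≠ (P, A) → ∀ t, (Path.segment p.1 p.2) t ∉ segment ℝ ℓ r) :
    (ps.map fun p => (Path.segment p.1 p.2).crossInc ℓ r).sum =
      2 * Real.pi * I * ((ps.count (A, P) : ℤ) - (ps.count (P, A) : ℤ)) := by
  classical
  have hAP : A ≠ P := by rintro rfl; linarith
  induction ps with
  | nil => simp
  | cons p ps ih =>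
    rw [List.map_cons, List.sum_cons, ih fun q hq => havoid q (by simp [hq])]
    rw [List.count_cons, List.count_cons]
    by_cases h1 : p = (A, P)
    · subst h1
      rw [Path.crossInc_segment_of_cross hA hP hx]
      have : ¬ ((A, P) == (P, A)) = true := by
        rw [beq_iff_eq]; simp only [Prod.mk.injEq, not_and]; exact fun h _ => hAP h
      simp only [beq_self_eq_true, ite_true, this]
      push_cast; ring
    by_cases h2 : p = (P, A)
    · subst h2
      have hx' : ∃ q ∈ segment ℝ P A, q ∈ openSegment ℝ ℓ r := by rw [segment_symm]; exact hx
      rw [Path.crossInc_segment_of_cross' hP hA hx']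
      have : ¬ ((P, A) == (A, P)) = true := by
        rw [beq_iff_eq]; simp only [Prod.mk.injEq, not_and]; exact fun h _ => hAP h.symm
      simp only [beq_self_eq_true, ite_true, this]
      push_cast; ring
    · rw [Path.crossInc_eq_zero _ (havoid p (by simp) h1 h2)]
      have h1' : ¬ (p == (A, P)) = true := by rw [beq_iff_eq]; exact h1
      have h2' : ¬ (p == (P, A)) = true := by rw [beq_iff_eq]; exact h2
      simp only [h1', h2']
      push_cast; ring

/-- The loop of a closed chain. [folklore] -/
def sideLoop (a : ℂ) (l : List ℂ) (h : chainEnd a l = a) : Path a a :=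
  (sidePath a l).cast rfl h.symm

/-- The loop has the same extension as the path. [folklore] -/
theorem sideLoop_extend (a : ℂ) (l : List ℂ) (h : chainEnd a l = a) :
    (sideLoop a l h).extend = (sidePath a l).extend := rfl

/-- The loop has the same range as the path. [folklore] -/
theorem range_sideLoop (a : ℂ) (l : List ℂ) (h : chainEnd a l = a) :
    range (sideLoop a l h) = range (sidePath a l) := rfl

/-- The loop has the same crossing defects as the path. [folklore] -/
theorem crossInc_sideLoop (a : ℂ) (l : List ℂ) (h : chainEnd a l = a) (ℓ r : ℂ) :
    (sideLoop a l h).crossInc ℓ r = (sidePath a l).crossInc ℓ r := by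
  unfold Path.crossInc Path.argInc
  rw [sideLoop_extend]
  congr 1
  simp only [h]

/-- **Winding numbers of a closed polygonal chain about the ends of a test segment.** If the
test segment `[ℓ, r]` separates `A` from `P`, crosses `[A, P]`, and is avoided by every piece
other than `[A, P]`, `[P, A]` and by the points `a`, then
`wind(ℓ) - wind(r) = N(A,P) - N(P,A)`. [folklore] -/
theorem wind_sub_wind_sideLoop {A P ℓ r a : ℂ} {l : List ℂ} (hcl : chainEnd a l = a)
    (hA : 0 < segSide ℓ r A) (hP : segSide ℓ r P < 0)
    (hx : ∃ q ∈ segment ℝ A P, q ∈ openSegment ℝ ℓ r) (hℓa : ℓ ≠ a) (hra : r ≠ a)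
    (hends : ∀ p ∈ pieces a l, ℓ ∉ segment ℝ p.1 p.2 ∧ r ∉ segment ℝ p.1 p.2)
    (havoid : ∀ p ∈ pieces a l, p ≠ (A, P) → p ≠ (P, A) →
      ∀ t, (Path.segment p.1 p.2) t ∉ segment ℝ ℓ r) :
    (wind (fun t => (sideLoop a l hcl).extend t - ℓ) : ℤ) -
        wind (fun t => (sideLoop a l hcl).extend t - r) =
      ((pieces a l).count (A, P) : ℤ) - ((pieces a l).count (P, A) : ℤ) := by
  classical
  have hℓ : ℓ ∉ range (sideLoop a l hcl) := by
    rw [range_sideLoop]; exact not_mem_range_sidePath hℓa fun p hp => (hends p hp).1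
  have hr : r ∉ range (sideLoop a l hcl) := by
    rw [range_sideLoop]; exact not_mem_range_sidePath hra fun p hp => (hends p hp).2
  have h1 := Path.crossInc_loop (sideLoop a l hcl) hℓ hr
  rw [crossInc_sideLoop, crossInc_sidePath hℓa hra hends, sum_crossInc_pieces hA hP hx havoid] at h1
  have hπ : (2 * Real.pi * I : ℂ) ≠ 0 := by
    apply mul_ne_zero (mul_ne_zero two_ne_zero ?_) Complex.I_ne_zero
    exact_mod_cast Real.pi_ne_zero
  have h2 : (((pieces a l).count (A, P) : ℤ) - ((pieces a l).count (P, A) : ℤ) : ℂ) =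
      ((wind (fun t => (sideLoop a l hcl).extend t - ℓ) -
        wind (fun t => (sideLoop a l hcl).extend t - r) : ℤ) : ℂ) := by
    apply mul_left_cancel₀ hπ
    rw [h1]; push_cast; ring
  exact_mod_cast h2.symm

end Paths

/-! ### §5 The test segment between the centres of the two rhombi at a side -/

namespace RhombicPlanarity

/-- `segSide` in terms of the cross product. [folklore] -/
theorem segSide_eq_cross (ℓ r z : ℂ) : segSide ℓ r z = cross (z - r) (z - ℓ) := by
  unfold segSide cross; rw [mul_comm]

/-- The cross product of `u` with `iu` is `‖u‖²`. [folklore] -/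
theorem cross_self_I_mul (u : ℂ) : cross u (I * u) = ‖u‖ ^ 2 := by
  rw [cross_apply, Complex.sq_norm, Complex.normSq_apply]; simp

/-- A closed segment splits at any of its points. [folklore] -/
theorem segment_subset_union_of_mem {x y ρ : ℂ} (hρ : ρ ∈ segment ℝ x y) :
    segment ℝ x y ⊆ segment ℝ x ρ ∪ segment ℝ ρ y := by
  obtain ⟨μ, hμ0, hμ1, rfl⟩ := exists_coord_of_mem_segment hρ
  intro X hX
  obtain ⟨ν, hν0, hν1, rfl⟩ := exists_coord_of_mem_segment hX
  rcases le_or_gt ν μ with h | h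
  · left
    rcases eq_or_lt_of_le hμ0 with hμ | hμ
    · have hν : ν = 0 := le_antisymm (hμ ▸ h) hν0
      rw [hν]; simp [left_mem_segment]
    · refine ⟨1 - ν / μ, ν / μ, by rw [sub_nonneg]; exact div_le_one_of_le₀ h hμ0, by positivity,
        by ring, ?_⟩
      simp only [Complex.real_smul]
      have hμne : (μ : ℂ) ≠ 0 := by exact_mod_cast hμ.ne'
      push_cast
      field_simp
      ring
  · right
    rcases eq_or_lt_of_le hμ1 with hμ | hμ
    · exfalso; rw [hμ] at h; linarith
    · refine ⟨1 - (ν - μ) / (1 - μ), (ν - μ) / (1 - μ), ?_, ?_, by ring, ?_⟩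
      · rw [sub_nonneg, div_le_one (by linarith)]; linarith
      · exact div_nonneg (by linarith) (by linarith)
      · simp only [Complex.real_smul]
        have hμne : (1 - μ : ℂ) ≠ 0 := by
          have : (1 - μ : ℝ) ≠ 0 := by linarith
          exact_mod_cast this
        push_cast
        field_simp
        ring

/-- Opposite signs: `|σ - σ'| = |σ| + |σ'|`. [folklore] -/
theorem abs_sub_eq_abs_add_abs {σ σ' : ℝ} (h : σ * σ' < 0) : |σ - σ'| = |σ| + |σ'| := by
  rcases lt_or_gt_of_ne (show σ ≠ 0 by rintro rfl; simp at h) with hσ | hσ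
  · have hσ' : 0 < σ' := by nlinarith
    rw [abs_of_neg hσ, abs_of_pos hσ', abs_of_neg (by linarith)]; ring
  · have hσ' : σ' < 0 := by nlinarith
    rw [abs_of_pos hσ, abs_of_neg hσ', abs_of_pos (by linarith)]; ring

/-- **The test segment.** Let two unit rhombi share the side `[A, A + u]` and lie on opposite
sides of it (side vectors `w`, `w'` at `A` with `(u × w)(u × w') < 0`), with centres
`m = A + u/2 + w/2`, `m' = A + u/2 + w'/2`. Then the segment `[m, m']` crosses the open side
`(A, A + u)` at a point of the open segment `(m, m')`, and the line `m m'` separates `A` from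
`A + u`. [folklore] -/
theorem crossing_geometry {A u w w' : ℂ} (hu : ‖u‖ = 1) (hw : ‖w‖ = 1) (hw' : ‖w'‖ = 1)
    (hneg : cross u w * cross u w' < 0) :
    (∃ ρ₁, ρ₁ ∈ openSegment ℝ A (A + u) ∧
      ρ₁ ∈ openSegment ℝ (A + u / 2 + w / 2) (A + u / 2 + w' / 2)) ∧
    segSide (A + u / 2 + w / 2) (A + u / 2 + w' / 2) A *
      segSide (A + u / 2 + w / 2) (A + u / 2 + w' / 2) (A + u) < 0 := by
  set σ := cross u w with hσ
  set σ' := cross u w' with hσ'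
  set a := dot u w with ha
  set a' := dot u w' with ha'
  have hσ0 : σ ≠ 0 := by rintro h; rw [h, zero_mul] at hneg; exact lt_irrefl _ hneg
  have hσ0' : σ' ≠ 0 := by rintro h; rw [h, mul_zero] at hneg; exact lt_irrefl _ hneg
  have ha1 : |a| < 1 := abs_dot_lt_one hu hw hσ0
  have ha1' : |a'| < 1 := abs_dot_lt_one hu hw' hσ0'
  have hwd : w = (a : ℂ) * u + (σ : ℂ) * (I * u) := eq_dot_add_cross_of_norm_eq_one hu w
  have hwd' : w' = (a' : ℂ) * u + (σ' : ℂ) * (I * u) := eq_dot_add_cross_of_norm_eq_one hu w'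
  have hIu : cross u (I * u) = 1 := by rw [cross_self_I_mul, hu]; norm_num
  have hIu' : cross (I * u) u = -1 := by rw [cross_comm, hIu]
  constructor
  · -- the crossing point
    set l0 : ℝ := σ / (σ - σ') with hl0
    have hne : σ - σ' ≠ 0 := by
      intro h; have : σ = σ' := by linarith
      rw [this] at hneg; nlinarith [mul_self_nonneg σ']
    have hl0pos : 0 < l0 := by
      rcases lt_or_gt_of_ne hσ0 with h | h
      · have : 0 < σ' := by nlinarith
        rw [hl0]; exact div_pos_of_neg_of_neg h (by linarith)
      · have : σ' < 0 := by nlinarith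
        rw [hl0]; exact div_pos h (by linarith)
    have hl0lt : l0 < 1 := by
      rcases lt_or_gt_of_ne hσ0 with h | h
      · have : 0 < σ' := by nlinarith
        rw [hl0, div_lt_one_of_neg (by linarith)]; linarith
      · have : σ' < 0 := by nlinarith
        rw [hl0, div_lt_one (by linarith)]; linarith
    set α : ℝ := (1 - l0) * a + l0 * a' with hα
    have hv : ((1 - l0 : ℝ) : ℂ) * w + (l0 : ℂ) * w' = (α : ℂ) * u := by
      have hl0σ : l0 * (σ - σ') = σ := by rw [hl0]; exact div_mul_cancel₀ σ hne
      have hcr : (1 - l0) * σ + l0 * σ' = 0 := by linear_combination (-1 : ℝ) * hl0σ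
      have hcr' : (1 - (l0 : ℂ)) * (σ : ℂ) + (l0 : ℂ) * (σ' : ℂ) = 0 := by exact_mod_cast hcr
      rw [hwd, hwd', hα]; push_cast
      linear_combination (I * u) * hcr'
    have hαlt : |α| < 1 := by
      have h1 : |α| ≤ (1 - l0) * |a| + l0 * |a'| := by
        rw [hα]
        calc |(1 - l0) * a + l0 * a'| ≤ |(1 - l0) * a| + |l0 * a'| := abs_add_le _ _
          _ = (1 - l0) * |a| + l0 * |a'| := by
            rw [abs_mul, abs_mul, abs_of_pos (by linarith), abs_of_pos hl0pos]
      have h2 : (1 - l0) * |a| + l0 * |a'| < (1 - l0) * 1 + l0 * 1 := by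
        have := mul_lt_mul_of_pos_left ha1 (show 0 < 1 - l0 by linarith)
        have := mul_lt_mul_of_pos_left ha1' hl0pos
        linarith
      linarith
    refine ⟨A + (((1 + α) / 2 : ℝ) : ℂ) * u, ?_, ?_⟩
    · have := mem_openSegment_of_coord A (A + u) (θ := (1 + α) / 2)
        (by have := (abs_lt.1 hαlt).1; linarith) (by have := (abs_lt.1 hαlt).2; linarith)
      simpa using this
    · refine ⟨1 - l0, l0, by linarith, hl0pos, by ring, ?_⟩
      simp only [Complex.real_smul]
      have e1 : ((1 - l0 : ℝ) : ℂ) * (A + u / 2 + w / 2) + (l0 : ℂ) * (A + u / 2 + w' / 2) =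
          A + u / 2 + (((1 - l0 : ℝ) : ℂ) * w + (l0 : ℂ) * w') / 2 := by push_cast; ring
      rw [e1, hv]; push_cast; ring
  · -- the signs at `A` and `A + u`
    have hτ : cross w' w = a' * σ - σ' * a := by
      rw [hwd, hwd']
      simp only [cross_add_left, cross_add_right, cross_ofReal_mul_left, cross_ofReal_mul_right,
        cross_self, hIu, hIu']
      ring
    have hsA : segSide (A + u / 2 + w / 2) (A + u / 2 + w' / 2) A = (σ - σ' + cross w' w) / 4 := by
      rw [segSide_eq_cross]
      have e1 : A - (A + u / 2 + w' / 2) = ((-(1:ℝ)/2 : ℝ) : ℂ) * (u + w') := by push_cast; ring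
      have e2 : A - (A + u / 2 + w / 2) = ((-(1:ℝ)/2 : ℝ) : ℂ) * (u + w) := by push_cast; ring
      rw [e1, e2, cross_ofReal_mul_left, cross_ofReal_mul_right, cross_add_left, cross_add_right,
        cross_add_right, cross_self, ← hσ, cross_comm w' u, ← hσ']
      ring
    have hsP : segSide (A + u / 2 + w / 2) (A + u / 2 + w' / 2) (A + u) =
        (-(σ - σ') + cross w' w) / 4 := by
      rw [segSide_eq_cross]
      have e1 : A + u - (A + u / 2 + w' / 2) = (((1:ℝ)/2 : ℝ) : ℂ) * (u - w') := by push_cast; ring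
      have e2 : A + u - (A + u / 2 + w / 2) = (((1:ℝ)/2 : ℝ) : ℂ) * (u - w) := by push_cast; ring
      rw [e1, e2, cross_ofReal_mul_left, cross_ofReal_mul_right, cross_sub_left, cross_sub_right,
        cross_sub_right, cross_self, ← hσ, cross_comm w' u, ← hσ']
      ring
    rw [hsA, hsP, hτ]
    have habs : |a' * σ - σ' * a| < |σ - σ'| := by
      rw [abs_sub_eq_abs_add_abs hneg]
      calc |a' * σ - σ' * a| ≤ |a' * σ| + |σ' * a| := abs_sub _ _
        _ = |a'| * |σ| + |σ'| * |a| := by rw [abs_mul, abs_mul]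
        _ < 1 * |σ| + |σ'| * 1 := by
          have h1 := mul_lt_mul_of_pos_right ha1' (abs_pos.2 hσ0)
          have h2 := mul_lt_mul_of_pos_left ha1 (abs_pos.2 hσ0')
          linarith
        _ = |σ| + |σ'| := by ring
    have hsq : (a' * σ - σ' * a) ^ 2 < (σ - σ') ^ 2 := sq_lt_sq.2 habs
    nlinarith [hsq]

end RhombicPlanarity

/-! ### §6 Side-loops in the tiling: the parity identity at one side -/

section SideLoops

open RhombicPlanarity

variable {V F : Type*} {G : SimpleGraph V} {emb : RhombicEmbedding G F} {ε : ℝ}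

/-- `[x, y]` is (as an unordered pair of endpoints) a side of some rhombus of the tiling.
[folklore] -/
def _root_.Literature.Probability.LatticeModels.RhombicEmbedding.IsSide
    (emb : RhombicEmbedding G F) (x y : ℂ) : Prop :=
  ∃ (d : G.Dart) (b : Bool), s(x, y) = s(emb.z d.fst, emb.c (emb.dartFace d b))

/-- Segments only depend on the unordered pair of endpoints. [folklore] -/
theorem segment_eq_of_sym2_eq {x y x' y' : ℂ} (h : s(x, y) = s(x', y')) :
    segment ℝ x y = segment ℝ x' y' := by
  rcases Sym2.eq_iff.1 h with ⟨rfl, rfl⟩ | ⟨rfl, rfl⟩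
  · rfl
  · exact segment_symm ℝ _ _

/-- A standard side contains no interior point of its rhombus. [folklore] -/
theorem not_mem_interior_of_mem_stdSide (hiso : emb.IsIsoradial) (d : G.Dart) (b : Bool) {X : ℂ}
    (hX : X ∈ segment ℝ (emb.z d.fst) (emb.c (emb.dartFace d b))) :
    X ∉ interior (emb.rhombus ⟨d.edge, d.edge_mem⟩) := by
  obtain ⟨hsum, hAB, hPQ, hAP, hBP⟩ := dart_quad' hiso d b
  rw [rhombus_eq_quad hiso d b]
  exact not_mem_interior_quad_of_mem_segment hsum hAB hPQ hAP hBP hX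

/-- **No side of any rhombus passes through the interior of a rhombus.** [folklore] -/
theorem not_mem_stdSide_of_mem_interior (hiso : emb.IsIsoradial) (hrh : emb.IsRhombicTiling)
    {e : G.edgeSet} {X : ℂ} (hXi : X ∈ interior (emb.rhombus e)) (d : G.Dart) (b : Bool) :
    X ∉ segment ℝ (emb.z d.fst) (emb.c (emb.dartFace d b)) := fun hX => by
  have h := edge_eq_of_isOpen_subset_rhombus hiso hrh isOpen_interior interior_subset hXi
    (segment_subset_rhombus hiso d b hX)
  subst h
  exact not_mem_interior_of_mem_stdSide hiso d b hX hXi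

/-- An interior point of a rhombus lies on no side of the tiling. [folklore] -/
theorem not_mem_segment_of_isSide (hiso : emb.IsIsoradial) (hrh : emb.IsRhombicTiling)
    {e : G.edgeSet} {X : ℂ} (hXi : X ∈ interior (emb.rhombus e)) {x y : ℂ} (hxy : emb.IsSide x y) :
    X ∉ segment ℝ x y := by
  obtain ⟨d, b, h⟩ := hxy
  rw [segment_eq_of_sym2_eq h]
  exact not_mem_stdSide_of_mem_interior hiso hrh hXi d b

/-- **A standard side of a rhombus met by one of its open sides is that side.** [folklore] -/
theorem sym2_eq_of_mem_openSegment_of_mem_stdSide (hiso : emb.IsIsoradial) {d d₁ : G.Dart}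
    (h : d₁.edge = d.edge) {b b₁ : Bool} {X : ℂ}
    (hX : X ∈ openSegment ℝ (emb.z d.fst) (emb.c (emb.dartFace d b)))
    (hX₁ : X ∈ segment ℝ (emb.z d₁.fst) (emb.c (emb.dartFace d₁ b₁))) :
    s(emb.z d₁.fst, emb.c (emb.dartFace d₁ b₁)) = s(emb.z d.fst, emb.c (emb.dartFace d b)) := by
  obtain ⟨hsum, hAB, hPQ, hAP, hBP⟩ := dart_quad' hiso d b
  obtain ⟨h1, h2, h3⟩ := not_mem_other_sides_of_mem_openSegment hsum hAB hPQ hAP hBP hX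
  have hbb : b₁ = b ∨ b₁ = !b := by cases b <;> cases b₁ <;> simp
  rcases (SimpleGraph.dart_edge_eq_iff _ _).1 h with rfl | rfl
  · rcases hbb with rfl | rfl
    · rfl
    · exfalso; apply h3; rw [segment_symm]; exact hX₁
  · rw [dartFace_symm hiso] at hX₁ ⊢
    rcases hbb with rfl | rfl
    · exfalso; apply h2; simpa using hX₁
    · exfalso; apply h1; rw [segment_symm]; simpa using hX₁

/-- The centre of the rhombus of `d` in side coordinates. [folklore] -/
theorem centre_eq (hiso : emb.IsIsoradial) (d : G.Dart) (b : Bool) :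
    (emb.z d.fst + emb.z d.snd) / 2 = emb.z d.fst + (emb.c (emb.dartFace d b) - emb.z d.fst) / 2 +
      (emb.c (emb.dartFace d (!b)) - emb.z d.fst) / 2 := by
  have hsum := (dart_quad' hiso d b).1
  linear_combination (-(1:ℂ)/2) * hsum

/-- The centre of a rhombus is an interior point. [folklore] -/
theorem centre_mem_interior (hiso : emb.IsIsoradial) (d : G.Dart) :
    (emb.z d.fst + emb.z d.snd) / 2 ∈ interior (emb.rhombus ⟨d.edge, d.edge_mem⟩) := by
  refine openSegment_z_subset_interior_rhombus hiso d ⟨1/2, 1/2, by norm_num, by norm_num,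
    by norm_num, ?_⟩
  simp only [Complex.real_smul]; push_cast; ring

/-- The interval `[m, ρ₁)` from an interior point to a boundary point is interior. [folklore] -/
theorem mem_interior_of_mem_segment_of_ne (e : G.edgeSet) {m ρ X : ℂ}
    (hm : m ∈ interior (emb.rhombus e)) (hρ : ρ ∈ emb.rhombus e) (hX : X ∈ segment ℝ m ρ)
    (hXρ : X ≠ ρ) : X ∈ interior (emb.rhombus e) := by
  rcases Mesh.eq_or_eq_or_mem_openSegment hX with rfl | rfl | h
  · exact hm
  · exact absurd rfl hXρ
  · exact (convex_rhombus e).openSegment_interior_closure_subset_interior hm (subset_closure hρ) h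

/-- In `ZMod 2`, differences are sums. [folklore] -/
theorem zmod_two_intCast_sub (x y : ℤ) : ((x - y : ℤ) : ZMod 2) = (x : ZMod 2) + (y : ZMod 2) := by
  have h2 : (2 : ZMod 2) = 0 := rfl
  push_cast
  linear_combination (-(y : ZMod 2)) * h2

/-- **The parity identity at one side.** For a closed chain of sides of the tiling and a side
`[A, P]` (`A = z d.fst`, `P = c (dartFace d b)`) with the rhombus of `d'` across it
(`exists_dart_across`): the number of traversals of `[A, P]` (in either direction) is congruent
modulo `2` to the sum of the winding numbers of the loop about the centres of the two rhombi.
[folklore] -/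
theorem count_add_count_zmod_two (hiso : emb.IsIsoradial) (hrh : emb.IsRhombicTiling)
    {a : ℂ} {l : List ℂ} (hcl : chainEnd a l = a)
    (hch : ∀ p ∈ pieces a l, emb.IsSide p.1 p.2) (d : G.Dart) (b : Bool) {d' : G.Dart} {b' : Bool}
    (hends : (emb.z d'.fst = emb.z d.fst ∧ emb.c (emb.dartFace d' b') = emb.c (emb.dartFace d b)) ∨
      (emb.z d'.fst = emb.c (emb.dartFace d b) ∧ emb.c (emb.dartFace d' b') = emb.z d.fst))
    (hfar : cross (emb.c (emb.dartFace d b) - emb.z d.fst)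
        (emb.c (emb.dartFace d' (!b')) - emb.z d'.fst) *
      cross (emb.c (emb.dartFace d b) - emb.z d.fst) (emb.c (emb.dartFace d (!b)) - emb.z d.fst) < 0) :
    ((((pieces a l).count (emb.z d.fst, emb.c (emb.dartFace d b)) +
        (pieces a l).count (emb.c (emb.dartFace d b), emb.z d.fst) : ℕ) : ZMod 2)) =
      ((wind (fun t => (sideLoop a l hcl).extend t - (emb.z d.fst + emb.z d.snd) / 2) : ℤ) : ZMod 2) +
      ((wind (fun t => (sideLoop a l hcl).extend t - (emb.z d'.fst + emb.z d'.snd) / 2) : ℤ) : ZMod 2) := by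
  classical
  -- the trivial loop
  cases l with
  | nil =>
    have h0 : ∀ m : ℂ, wind (fun t => (sideLoop a [] hcl).extend t - m) = 0 := fun m => by
      have : (fun t => (sideLoop a [] hcl).extend t - m) = fun _ => a - m := by
        funext t; rw [sideLoop_extend]; simp [sidePath_nil]
      rw [this, wind_const]
    simp [h0]
  | cons b₀ l =>
  obtain ⟨hsum, hAB, hPQ, hAP, hBP⟩ := dart_quad' hiso d b
  obtain ⟨hsum', hAB', hPQ', hAP', hBP'⟩ := dart_quad' hiso d' b'
  set A := emb.z d.fst with hA
  set P := emb.c (emb.dartFace d b) with hP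
  set B := emb.z d.snd with hB
  set Q := emb.c (emb.dartFace d (!b)) with hQ
  set A' := emb.z d'.fst with hA'
  set P' := emb.c (emb.dartFace d' b') with hP'
  set B' := emb.z d'.snd with hB'
  set Q' := emb.c (emb.dartFace d' (!b')) with hQ'
  set u : ℂ := P - A with hu
  set w : ℂ := Q - A with hw
  set w' : ℂ := Q' - A' with hw'
  have hun : ‖u‖ = 1 := by rw [hu, norm_sub_rev, hAP]
  have hwn : ‖w‖ = 1 := by
    have : w = B - P := by rw [hw]; linear_combination hsum
    rw [this, hBP]
  have hwn' : ‖w'‖ = 1 := by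
    have : w' = B' - P' := by rw [hw']; linear_combination hsum'
    rw [this, hBP']
  have hPu : P = A + u := by rw [hu]; ring
  -- centres
  set m : ℂ := (A + B) / 2 with hm
  set m' : ℂ := (A' + B') / 2 with hm'
  have hmeq : m = A + u / 2 + w / 2 := by rw [hm, hu, hw]; linear_combination (-(1:ℂ)/2) * hsum
  have hmeq' : m' = A + u / 2 + w' / 2 := by
    rw [hm', hu, hw']
    rcases hends with ⟨h1, h2⟩ | ⟨h1, h2⟩
    · rw [← h1, ← h2]; linear_combination (-(1:ℂ)/2) * hsum'
    · have e1 : A' = P := h1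
      have e2 : P' = A := h2
      linear_combination (-(1:ℂ)/2) * hsum' + e1 - (1:ℂ)/2 * e1 + (1:ℂ)/2 * e2
  have hmi : m ∈ interior (emb.rhombus ⟨d.edge, d.edge_mem⟩) := centre_mem_interior hiso d
  have hmi' : m' ∈ interior (emb.rhombus ⟨d'.edge, d'.edge_mem⟩) := centre_mem_interior hiso d'
  -- the test segment `[m, m']`
  have hneg : cross u w * cross u w' < 0 := by rw [mul_comm]; exact hfar
  obtain ⟨⟨ρ₁, hρ₁, hρ₁m⟩, hsign⟩ := crossing_geometry (A := A) hun hwn hwn' hneg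
  rw [← hPu, ← hmeq, ← hmeq'] at *
  have hρ₁d : ρ₁ ∈ emb.rhombus ⟨d.edge, d.edge_mem⟩ :=
    segment_subset_rhombus hiso d b (openSegment_subset_segment ℝ _ _ hρ₁)
  have hρ₁' : ρ₁ ∈ openSegment ℝ A' P' := by
    rcases hends with ⟨h1, h2⟩ | ⟨h1, h2⟩
    · rw [show A' = A from h1, show P' = P from h2]; exact hρ₁
    · rw [show A' = P from h1, show P' = A from h2, openSegment_symm]; exact hρ₁
  have hρ₁d' : ρ₁ ∈ emb.rhombus ⟨d'.edge, d'.edge_mem⟩ :=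
    segment_subset_rhombus hiso d' b' (openSegment_subset_segment ℝ _ _ hρ₁')
  obtain ⟨δ, hδ, hcov⟩ := ball_subset_union_of_across hiso d b hρ₁ d' b' hends hfar
  -- pieces avoid the centres
  have hends2 : ∀ p ∈ pieces a (b₀ :: l), m ∉ segment ℝ p.1 p.2 ∧ m' ∉ segment ℝ p.1 p.2 :=
    fun p hp => ⟨not_mem_segment_of_isSide hiso hrh hmi (hch p hp),
      not_mem_segment_of_isSide hiso hrh hmi' (hch p hp)⟩
  have hma : m ≠ a := fun h =>
    (hends2 (a, b₀) (by simp)).1 (h ▸ left_mem_segment ℝ a b₀)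
  have hma' : m' ≠ a := fun h =>
    (hends2 (a, b₀) (by simp)).2 (h ▸ left_mem_segment ℝ a b₀)
  -- pieces other than `[A, P]` avoid the whole test segment
  have hρ₁side : ∀ (d'' : G.Dart) (b'' : Bool),
      ρ₁ ∈ segment ℝ (emb.z d''.fst) (emb.c (emb.dartFace d'' b'')) →
        s(emb.z d''.fst, emb.c (emb.dartFace d'' b'')) = s(A, P) := by
    intro d'' b'' hρ
    rcases edge_eq_or_eq_of_mem_rhombus hiso hrh hδ hcov (segment_subset_rhombus hiso d'' b'' hρ)
      with h | h
    · exact sym2_eq_of_mem_openSegment_of_mem_stdSide hiso (congrArg Subtype.val h) hρ₁ hρ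
    · rw [sym2_eq_of_mem_openSegment_of_mem_stdSide hiso (congrArg Subtype.val h) hρ₁' hρ]
      change s(A', P') = s(A, P)
      rcases hends with ⟨h1, h2⟩ | ⟨h1, h2⟩
      · rw [show A' = A from h1, show P' = P from h2]
      · rw [show A' = P from h1, show P' = A from h2, Sym2.eq_swap]
  have havoid_seg : ∀ x y, emb.IsSide x y → s(x, y) ≠ s(A, P) →
      ∀ X, X ∈ segment ℝ x y → X ∉ segment ℝ m m' := by
    intro x y hside hxy X hX hXm
    obtain ⟨d'', b'', hs⟩ := hside
    rw [segment_eq_of_sym2_eq hs] at hX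
    have hXρ : X ≠ ρ₁ := by
      rintro rfl; exact hxy (hs.trans (hρ₁side d'' b'' hX))
    rcases segment_subset_union_of_mem (openSegment_subset_segment ℝ _ _ hρ₁m) hXm with h | h
    · exact not_mem_stdSide_of_mem_interior hiso hrh
        (mem_interior_of_mem_segment_of_ne _ hmi hρ₁d h hXρ) d'' b'' hX
    · rw [segment_symm] at h
      exact not_mem_stdSide_of_mem_interior hiso hrh
        (mem_interior_of_mem_segment_of_ne _ hmi' hρ₁d' h hXρ) d'' b'' hX
  have hAPne : A ≠ P := by intro h; rw [h, sub_self, norm_zero] at hAP; exact zero_ne_one hAP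
  have havoid : ∀ (ℓ r : ℂ), segment ℝ ℓ r = segment ℝ m m' →
      ∀ p ∈ pieces a (b₀ :: l), p ≠ (A, P) → p ≠ (P, A) →
        ∀ t, (Path.segment p.1 p.2) t ∉ segment ℝ ℓ r := by
    intro ℓ r hℓr p hp h1 h2 t
    rw [hℓr]
    have hs : s(p.1, p.2) ≠ s(A, P) := by
      intro h; rcases Sym2.eq_iff.1 h with ⟨h3, h4⟩ | ⟨h3, h4⟩
      · exact h1 (Prod.ext h3 h4)
      · exact h2 (Prod.ext h3 h4)
    refine havoid_seg p.1 p.2 (hch p hp) hs _ ?_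
    have : (Path.segment p.1 p.2) t ∈ range (Path.segment p.1 p.2) := mem_range_self t
    rwa [Path.range_segment] at this
  -- the winding identity, with the test segment oriented so that `A` is on the positive side
  have key : ((wind (fun t => (sideLoop a (b₀ :: l) hcl).extend t - m) : ℤ) : ZMod 2) +
      ((wind (fun t => (sideLoop a (b₀ :: l) hcl).extend t - m') : ℤ) : ZMod 2) =
      ((((pieces a (b₀ :: l)).count (A, P) : ℤ) - ((pieces a (b₀ :: l)).count (P, A) : ℤ) : ℤ) :
        ZMod 2) := by
    rcases lt_or_gt_of_ne (show segSide m m' A ≠ 0 by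
        intro h; rw [h, zero_mul] at hsign; exact lt_irrefl _ hsign) with hsA | hsA
    · -- swap the ends (`segSide_swap` of `InterfaceLoopPolygon`, inlined to keep imports light)
      have hswap : ∀ z, segSide m' m z = -segSide m m' z := fun z => by
        rw [segSide_eq_cross, segSide_eq_cross, cross_comm]
      have hsP : 0 < segSide m m' P := by nlinarith
      have hA' : 0 < segSide m' m A := by rw [hswap]; linarith
      have hP' : segSide m' m P < 0 := by rw [hswap]; linarith
      have hx : ∃ q ∈ segment ℝ A P, q ∈ openSegment ℝ m' m :=
        ⟨ρ₁, openSegment_subset_segment ℝ _ _ hρ₁, by rw [openSegment_symm]; exact hρ₁m⟩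
      have h := wind_sub_wind_sideLoop hcl hA' hP' hx hma' hma
        (fun p hp => ⟨(hends2 p hp).2, (hends2 p hp).1⟩)
        (havoid m' m (segment_symm ℝ _ _))
      rw [← h, zmod_two_intCast_sub, add_comm]
    · have hsP : segSide m m' P < 0 := by nlinarith
      have hx : ∃ q ∈ segment ℝ A P, q ∈ openSegment ℝ m m' :=
        ⟨ρ₁, openSegment_subset_segment ℝ _ _ hρ₁, hρ₁m⟩
      have h := wind_sub_wind_sideLoop hcl hsA hsP hx hma hma' hends2 (havoid m m' rfl)
      rw [← h, zmod_two_intCast_sub]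
  rw [key, zmod_two_intCast_sub]
  push_cast
  ring

/-! ### §7 Even side-loops -/

/-- The unordered pair of endpoints of the standard side slot `(d, b)`. [folklore] -/
def _root_.Literature.Probability.LatticeModels.RhombicEmbedding.stdSide
    (emb : RhombicEmbedding G F) (db : G.Dart × Bool) : Sym2 ℂ :=
  s(emb.z db.1.fst, emb.c (emb.dartFace db.1 db.2))

/-- The centre of the rhombus of an edge. [folklore] -/
def _root_.Literature.Probability.LatticeModels.RhombicEmbedding.tileCentre
    (emb : RhombicEmbedding G F) (e : G.edgeSet) : ℂ :=
  (emb.z (RhombicEmbedding.refDart e).fst + emb.z (RhombicEmbedding.refDart e).snd) / 2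

/-- The four sides (as unordered pairs of endpoints) of the rhombus of an edge. [folklore] -/
def _root_.Literature.Probability.LatticeModels.RhombicEmbedding.tileSides
    (emb : RhombicEmbedding G F) (e : G.edgeSet) : Finset (Sym2 ℂ) :=
  {s(emb.z (RhombicEmbedding.refDart e).fst, emb.c (emb.leftFace (RhombicEmbedding.refDart e))),
    s(emb.z (RhombicEmbedding.refDart e).fst, emb.c (emb.rightFace (RhombicEmbedding.refDart e))),
    s(emb.z (RhombicEmbedding.refDart e).snd, emb.c (emb.rightFace (RhombicEmbedding.refDart e))),
    s(emb.z (RhombicEmbedding.refDart e).snd, emb.c (emb.leftFace (RhombicEmbedding.refDart e)))}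

/-- Unfolding `stdSide`. [folklore] -/
@[simp] theorem stdSide_mk (d : G.Dart) (b : Bool) :
    emb.stdSide (d, b) = s(emb.z d.fst, emb.c (emb.dartFace d b)) := rfl

/-- The reference dart of the edge of `d` is `d` or `d.symm`. [folklore] -/
theorem refDart_eq_or (d : G.Dart) :
    RhombicEmbedding.refDart (⟨d.edge, d.edge_mem⟩ : G.edgeSet) = d ∨
      RhombicEmbedding.refDart (⟨d.edge, d.edge_mem⟩ : G.edgeSet) = d.symm :=
  (SimpleGraph.dart_edge_eq_iff _ _).1 (RhombicEmbedding.refDart_edge _)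

/-- The centre of the rhombus of a dart. [folklore] -/
theorem tileCentre_dart (d : G.Dart) :
    emb.tileCentre ⟨d.edge, d.edge_mem⟩ = (emb.z d.fst + emb.z d.snd) / 2 := by
  unfold RhombicEmbedding.tileCentre
  rcases refDart_eq_or d with h | h <;> rw [h]
  simp [add_comm]

/-- The centre of a rhombus is an interior point. [folklore] -/
theorem tileCentre_mem_interior (hiso : emb.IsIsoradial) (e : G.edgeSet) :
    emb.tileCentre e ∈ interior (emb.rhombus e) := by
  rw [← edge_refDart e]
  rw [tileCentre_dart]
  exact centre_mem_interior hiso _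

/-- The four sides of the rhombus of `d`, listed from `d` and a face choice. [folklore] -/
theorem tileSides_dart (hiso : emb.IsIsoradial) (d : G.Dart) (b : Bool) :
    emb.tileSides ⟨d.edge, d.edge_mem⟩ =
      {s(emb.z d.fst, emb.c (emb.dartFace d b)), s(emb.z d.fst, emb.c (emb.dartFace d (!b))),
        s(emb.z d.snd, emb.c (emb.dartFace d (!b))), s(emb.z d.snd, emb.c (emb.dartFace d b))} := by
  unfold RhombicEmbedding.tileSides
  have h1 := hiso.leftFace_symm d
  have h2 : emb.rightFace d.symm = emb.leftFace d := by
    have := hiso.leftFace_symm d.symm; rw [SimpleGraph.Dart.symm_symm] at this; exact this.symm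
  rcases refDart_eq_or d with h | h <;> rw [h] <;> cases b <;>
    simp only [dartFace_true, dartFace_false, Bool.not_true, Bool.not_false,
      SimpleGraph.Dart.symm_toProd, Prod.fst_swap, Prod.snd_swap, h1, h2] <;>
    ext σ <;> simp only [Finset.mem_insert, Finset.mem_singleton] <;> tauto

/-- **Membership in the side set.** [folklore] -/
theorem mem_tileSides_iff (hiso : emb.IsIsoradial) (e : G.edgeSet) (σ : Sym2 ℂ) :
    σ ∈ emb.tileSides e ↔ ∃ (d : G.Dart) (b : Bool), d.edge = e ∧ emb.stdSide (d, b) = σ := by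
  set d₀ := RhombicEmbedding.refDart e with hd₀
  have he : (⟨d₀.edge, d₀.edge_mem⟩ : G.edgeSet) = e := edge_refDart e
  constructor
  · intro h
    rw [← he, tileSides_dart hiso d₀ true] at h
    simp only [Finset.mem_insert, Finset.mem_singleton] at h
    rcases h with rfl | rfl | rfl | rfl
    · exact ⟨d₀, true, congrArg Subtype.val he, rfl⟩
    · exact ⟨d₀, false, congrArg Subtype.val he, rfl⟩
    · refine ⟨d₀.symm, true, d₀.edge_symm.trans (congrArg Subtype.val he), ?_⟩
      rw [stdSide_mk, dartFace_symm hiso]; rfl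
    · refine ⟨d₀.symm, false, d₀.edge_symm.trans (congrArg Subtype.val he), ?_⟩
      rw [stdSide_mk, dartFace_symm hiso]; rfl
  · rintro ⟨d, b, hde, rfl⟩
    have : e = ⟨d.edge, d.edge_mem⟩ := Subtype.ext hde.symm
    subst this
    rw [tileSides_dart hiso d b]
    simp

/-- A standard side slot gives a side of its rhombus. [folklore] -/
theorem stdSide_mem_tileSides (hiso : emb.IsIsoradial) (d : G.Dart) (b : Bool) :
    emb.stdSide (d, b) ∈ emb.tileSides ⟨d.edge, d.edge_mem⟩ :=
  (mem_tileSides_iff hiso _ _).2 ⟨d, b, rfl, rfl⟩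

/-- Bookkeeping. [folklore] -/
theorem sym2_ne_of {x y x' y' : ℂ} (h1 : x ≠ x' ∨ y ≠ y') (h2 : x ≠ y' ∨ y ≠ x') :
    s(x, y) ≠ s(x', y') := by
  intro h
  rcases Sym2.eq_iff.1 h with ⟨rfl, rfl⟩ | ⟨rfl, rfl⟩
  · simp at h1
  · simp at h2

/-- **A rhombus has four distinct sides.** [folklore] -/
theorem card_tileSides (hiso : emb.IsIsoradial) (e : G.edgeSet) : (emb.tileSides e).card = 4 := by
  set d := RhombicEmbedding.refDart e
  rw [← edge_refDart e, tileSides_dart hiso d true]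
  obtain ⟨hsum, hAB, hPQ, hAP, hBP⟩ := dart_quad' hiso d true
  set A := emb.z d.fst
  set P := emb.c (emb.dartFace d true)
  set B := emb.z d.snd
  set Q := emb.c (emb.dartFace d (!true))
  have hAP' : A ≠ P := by intro h; rw [h, sub_self, norm_zero] at hAP; exact zero_ne_one hAP
  have hBP' : B ≠ P := by intro h; rw [h, sub_self, norm_zero] at hBP; exact zero_ne_one hBP
  have hAQ' : A ≠ Q := by
    intro h
    have : ‖A - Q‖ = 1 := by
      have e1 : A - Q = -(B - P) := by linear_combination (-1:ℂ) * hsum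
      rw [e1, norm_neg, hBP]
    rw [h, sub_self, norm_zero] at this; exact zero_ne_one this
  have hBQ' : B ≠ Q := by
    intro h
    have : ‖B - Q‖ = 1 := by
      have e1 : B - Q = -(A - P) := by linear_combination (-1:ℂ) * hsum
      rw [e1, norm_neg, hAP]
    rw [h, sub_self, norm_zero] at this; exact zero_ne_one this
  rw [Finset.card_insert_of_notMem, Finset.card_insert_of_notMem, Finset.card_pair]
  · exact sym2_ne_of (Or.inr hPQ.symm) (Or.inl hBP')
  · simp only [Finset.mem_insert, Finset.mem_singleton, not_or]
    exact ⟨sym2_ne_of (Or.inl hAB) (Or.inl hAQ'), sym2_ne_of (Or.inl hAB) (Or.inr hBQ'.symm)⟩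
  · simp only [Finset.mem_insert, Finset.mem_singleton, not_or]
    exact ⟨sym2_ne_of (Or.inr hPQ) (Or.inl hAQ'), sym2_ne_of (Or.inl hAB) (Or.inr hBP'.symm),
      sym2_ne_of (Or.inl hAB) (Or.inl hAP')⟩

/-- Counting the traversals of a side in either direction. [folklore] -/
theorem count_map_sym2 {A P : ℂ} (hAP : A ≠ P) (ps : List (ℂ × ℂ)) :
    (ps.map fun p => s(p.1, p.2)).count s(A, P) = ps.count (A, P) + ps.count (P, A) := by
  classical
  induction ps with
  | nil => simp
  | cons p ps ih =>
    rw [List.map_cons, List.count_cons, List.count_cons, List.count_cons, ih]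
    by_cases h1 : p = (A, P)
    · subst h1
      have hne : ¬ ((A, P) == (P, A)) = true := by
        rw [beq_iff_eq]; simp only [Prod.mk.injEq, not_and]; exact fun h _ => hAP h
      simp [hne]; omega
    by_cases h2 : p = (P, A)
    · subst h2
      have hne : ¬ ((P, A) == (A, P)) = true := by
        rw [beq_iff_eq]; simp only [Prod.mk.injEq, not_and]; exact fun h _ => hAP h.symm
      have heq : (s(P, A) == s(A, P)) = true := by rw [beq_iff_eq, Sym2.eq_swap]
      simp [hne, heq]; omega
    · have hs : ¬ (s(p.1, p.2) == s(A, P)) = true := by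
        rw [beq_iff_eq]; intro h
        rcases Sym2.eq_iff.1 h with ⟨h3, h4⟩ | ⟨h3, h4⟩
        · exact h1 (Prod.ext h3 h4)
        · exact h2 (Prod.ext h3 h4)
      have h1' : ¬ (p == (A, P)) = true := by rw [beq_iff_eq]; exact h1
      have h2' : ¬ (p == (P, A)) = true := by rw [beq_iff_eq]; exact h2
      simp [hs, h1', h2']

/-- A bound for the norms of a finite list of points. [folklore] -/
theorem exists_norm_le_of_list (L : List ℂ) : ∃ R : ℝ, 0 ≤ R ∧ ∀ x ∈ L, ‖x‖ ≤ R := by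
  induction L with
  | nil => exact ⟨0, le_rfl, by simp⟩
  | cons y L ih =>
    obtain ⟨R, hR0, hR⟩ := ih
    refine ⟨max ‖y‖ R, le_max_of_le_right hR0, fun x hx => ?_⟩
    simp only [List.mem_cons] at hx
    rcases hx with rfl | hx
    · exact le_max_left _ _
    · exact (hR x hx).trans (le_max_right _ _)

/-- The midpoint of a standard side lies on its open side. [folklore] -/
theorem midpoint_mem_openSegment (A P : ℂ) : (A + P) / 2 ∈ openSegment ℝ A P :=
  ⟨1/2, 1/2, by norm_num, by norm_num, by norm_num, by simp only [Complex.real_smul]; push_cast; ring⟩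

/-- The midpoint only depends on the unordered pair. [folklore] -/
theorem midpoint_eq_of_sym2_eq {x y x' y' : ℂ} (h : s(x, y) = s(x', y')) :
    (x + y) / 2 = (x' + y') / 2 := by
  rcases Sym2.eq_iff.1 h with ⟨rfl, rfl⟩ | ⟨rfl, rfl⟩
  · rfl
  · ring

/-- **Even side-loops.** In an isoradial rhombic tiling with bounded angles, no vertex without
neighbour and no T-junctions, every closed walk along sides of rhombi has even length — the
corner graph of the tiling is bipartite (Grimmett–Manolescu 2014, §4.1: the diamond graph is
bipartite, with `G` and `G*` as colour classes; de Bruijn 1981, §4). Proof: double counting of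
`Σ_σ (traversals of σ) ≡ Σ_σ (wind(e₁ σ) + wind(e₂ σ)) = Σ_e 4·wind(e) ≡ 0 (mod 2)` over the
sides `σ` of the finitely many rhombi near the loop, `e₁ σ, e₂ σ` being the two rhombi at `σ`.
[cite: GrimmettManolescu2014Isoradial, §4.1 (the diamond graph is a rhombic tiling)] -/
theorem even_length_of_isSideLoop (hiso : emb.IsIsoradial) (hrh : emb.IsRhombicTiling)
    (hbap : emb.HasBoundedAngles ε) (hε : 0 < ε) (hnb : ∀ v : V, ∃ u, G.Adj v u)
    (hT : emb.NoTJunction) {a : ℂ} {l : List ℂ} (hcl : chainEnd a l = a)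
    (hch : ∀ p ∈ pieces a l, emb.IsSide p.1 p.2) : Even l.length := by
  classical
  cases l with
  | nil => exact ⟨0, rfl⟩
  | cons b₀ l =>
  -- notation
  set L := b₀ :: l with hL
  set γ := sideLoop a L hcl with hγ
  set wnd : G.edgeSet → ℤ := fun e => wind (fun t => γ.extend t - emb.tileCentre e) with hwnd
  -- a disc containing the loop
  obtain ⟨R₀, hR₀0, hR₀⟩ := exists_norm_le_of_list (a :: L)
  have hdist : ∀ t ∈ Icc (0:ℝ) 1, dist (γ.extend t) 0 ≤ R₀ := by
    intro t ht
    rw [Path.extend_apply γ ht]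
    change dist (sidePath a L ⟨t, ht⟩) 0 ≤ R₀
    exact dist_sidePath_le (fun x hx => by rw [dist_zero_right]; exact hR₀ x hx) _
  -- the rhombi meeting the disc, and a larger disc
  set T₀ : Finset G.edgeSet :=
    (finite_setOf_rhombus_meets hiso hrh hbap hε hnb 0 R₀).toFinset with hT₀
  set T₁ : Finset G.edgeSet :=
    (finite_setOf_rhombus_meets hiso hrh hbap hε hnb 0 (R₀ + 4)).toFinset with hT₁
  have hmemT₀ : ∀ e : G.edgeSet, e ∈ T₀ ↔ ∃ X ∈ emb.rhombus e, ‖X‖ ≤ R₀ := by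
    intro e; rw [hT₀, Set.Finite.mem_toFinset]; simp
  have hmemT₁ : ∀ e : G.edgeSet, e ∈ T₁ ↔ ∃ X ∈ emb.rhombus e, ‖X‖ ≤ R₀ + 4 := by
    intro e; rw [hT₁, Set.Finite.mem_toFinset]; simp
  have hT₀₁ : T₀ ⊆ T₁ := by
    intro e he; rw [hmemT₀] at he; rw [hmemT₁]
    obtain ⟨X, hX, hXn⟩ := he; exact ⟨X, hX, by linarith⟩
  -- far rhombi have winding number zero
  have hwnd0 : ∀ e, e ∉ T₀ → wnd e = 0 := by
    intro e he
    rw [hmemT₀] at he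
    have hc : R₀ < ‖emb.tileCentre e‖ :=
      lt_of_not_ge fun h => he ⟨_, interior_subset (tileCentre_mem_interior hiso e), h⟩
    apply wind_sub_eq_zero_of_dist_le (Γ := γ.extend) γ.continuous_extend.continuousOn
      (by rw [Path.extend_zero, Path.extend_one]) hdist
    rwa [dist_zero_right]
  -- the darts of the rhombi of `T₀` and their sides
  set D₀ : Finset G.Dart := T₀.biUnion fun e =>
    {RhombicEmbedding.refDart e, (RhombicEmbedding.refDart e).symm} with hD₀
  have hmemD₀ : ∀ d : G.Dart, d ∈ D₀ ↔ (⟨d.edge, d.edge_mem⟩ : G.edgeSet) ∈ T₀ := by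
    intro d
    rw [hD₀, Finset.mem_biUnion]
    constructor
    · rintro ⟨e, he, hd⟩
      simp only [Finset.mem_insert, Finset.mem_singleton] at hd
      have : (⟨d.edge, d.edge_mem⟩ : G.edgeSet) = e := by
        rcases hd with rfl | rfl
        · exact edge_refDart e
        · exact Subtype.ext (((RhombicEmbedding.refDart e).edge_symm).trans
            (RhombicEmbedding.refDart_edge e))
      rw [this]; exact he
    · intro h
      refine ⟨_, h, ?_⟩
      simp only [Finset.mem_insert, Finset.mem_singleton]
      rcases refDart_eq_or d with h' | h'
      · exact Or.inl h'.symm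
      · right; rw [h', SimpleGraph.Dart.symm_symm]
  set S : Finset (Sym2 ℂ) := (D₀ ×ˢ (Finset.univ : Finset Bool)).image emb.stdSide with hS
  have hmemS : ∀ σ, σ ∈ S ↔ ∃ (d : G.Dart) (b : Bool),
      (⟨d.edge, d.edge_mem⟩ : G.edgeSet) ∈ T₀ ∧ emb.stdSide (d, b) = σ := by
    intro σ
    rw [hS, Finset.mem_image]
    constructor
    · rintro ⟨⟨d, b⟩, hdb, rfl⟩
      rw [Finset.mem_product] at hdb
      exact ⟨d, b, (hmemD₀ d).1 hdb.1, rfl⟩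
    · rintro ⟨d, b, hd, rfl⟩
      exact ⟨(d, b), Finset.mem_product.2 ⟨(hmemD₀ d).2 hd, Finset.mem_univ _⟩, rfl⟩
  have hSides_sub : ∀ e ∈ T₀, emb.tileSides e ⊆ S := by
    intro e he σ hσ
    obtain ⟨d, b, hde, rfl⟩ := (mem_tileSides_iff hiso e σ).1 hσ
    rw [hmemS]
    refine ⟨d, b, ?_, rfl⟩
    rw [show (⟨d.edge, d.edge_mem⟩ : G.edgeSet) = e from Subtype.ext hde]; exact he
  -- representatives and the tile across, for each side in `S`
  have hrep : ∀ σ ∈ S, ∃ (d : G.Dart) (b : Bool),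
      (⟨d.edge, d.edge_mem⟩ : G.edgeSet) ∈ T₀ ∧ emb.stdSide (d, b) = σ := fun σ hσ => (hmemS σ).1 hσ
  obtain ⟨d₀₀, -, -⟩ := hch (a, b₀) (by simp [hL])
  haveI : Nonempty G.Dart := ⟨d₀₀⟩
  choose! d₁ b₁ hd₁T hd₁σ using hrep
  have hacross : ∀ σ ∈ S, ∃ (d' : G.Dart) (b' : Bool), d'.edge ≠ (d₁ σ).edge ∧
      (emb.z (d₁ σ).fst + emb.c (emb.dartFace (d₁ σ) (b₁ σ))) / 2 ∈
        emb.rhombus ⟨d'.edge, d'.edge_mem⟩ ∧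
      ((emb.z d'.fst = emb.z (d₁ σ).fst ∧
          emb.c (emb.dartFace d' b') = emb.c (emb.dartFace (d₁ σ) (b₁ σ))) ∨
        (emb.z d'.fst = emb.c (emb.dartFace (d₁ σ) (b₁ σ)) ∧
          emb.c (emb.dartFace d' b') = emb.z (d₁ σ).fst)) ∧
      cross (emb.c (emb.dartFace (d₁ σ) (b₁ σ)) - emb.z (d₁ σ).fst)
          (emb.c (emb.dartFace d' (!b')) - emb.z d'.fst) *
        cross (emb.c (emb.dartFace (d₁ σ) (b₁ σ)) - emb.z (d₁ σ).fst)
          (emb.c (emb.dartFace (d₁ σ) (!(b₁ σ))) - emb.z (d₁ σ).fst) < 0 :=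
    fun σ hσ => exists_dart_across hiso hrh hbap hε hnb hT (d₁ σ) (b₁ σ)
      (midpoint_mem_openSegment _ _)
  choose! d₂ b₂ hne₂ hρ₂ hends₂ hfar₂ using hacross
  set e₁ : Sym2 ℂ → G.edgeSet := fun σ => ⟨(d₁ σ).edge, (d₁ σ).edge_mem⟩ with he₁
  set e₂ : Sym2 ℂ → G.edgeSet := fun σ => ⟨(d₂ σ).edge, (d₂ σ).edge_mem⟩ with he₂
  have hne₁₂ : ∀ σ ∈ S, e₁ σ ≠ e₂ σ := fun σ hσ h => hne₂ σ hσ (congrArg Subtype.val h).symm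
  have he₁T : ∀ σ ∈ S, e₁ σ ∈ T₀ := fun σ hσ => hd₁T σ hσ
  have he₂T : ∀ σ ∈ S, e₂ σ ∈ T₁ := by
    intro σ hσ
    rw [hmemT₁]
    refine ⟨_, hρ₂ σ hσ, ?_⟩
    -- the midpoint is within `4` of a point of norm `≤ R₀` in the rhombus of `d₁ σ`
    obtain ⟨X, hX, hXn⟩ := (hmemT₀ _).1 (he₁T σ hσ)
    set μ : ℂ := (emb.z (d₁ σ).fst + emb.c (emb.dartFace (d₁ σ) (b₁ σ))) / 2 with hμ
    have h1 : ‖X - emb.z (d₁ σ).fst‖ ≤ 2 := norm_sub_z_le_two_of_mem_rhombus hiso hX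
    have h2 : ‖μ - emb.z (d₁ σ).fst‖ ≤ 2 :=
      norm_sub_z_le_two_of_mem_rhombus hiso (segment_subset_rhombus hiso (d₁ σ) (b₁ σ)
        (openSegment_subset_segment ℝ _ _ (midpoint_mem_openSegment _ _)))
    have h3 := norm_add_le X (μ - emb.z (d₁ σ).fst)
    have h4 : ‖μ‖ ≤ ‖X + (μ - emb.z (d₁ σ).fst)‖ + ‖X - emb.z (d₁ σ).fst‖ := by
      have := norm_sub_le (X + (μ - emb.z (d₁ σ).fst)) (X - emb.z (d₁ σ).fst)
      have e1 : X + (μ - emb.z (d₁ σ).fst) - (X - emb.z (d₁ σ).fst) = μ := by ring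
      rwa [e1] at this
    linarith
  -- incidence: `e ∈ {e₁ σ, e₂ σ}` iff `σ` is a side of `e`
  have hσ₁ : ∀ σ ∈ S, σ ∈ emb.tileSides (e₁ σ) := by
    intro σ hσ
    have h := stdSide_mem_tileSides hiso (d₁ σ) (b₁ σ)
    rw [hd₁σ σ hσ] at h
    exact h
  have hσ₂ : ∀ σ ∈ S, σ ∈ emb.tileSides (e₂ σ) := by
    intro σ hσ
    rw [mem_tileSides_iff hiso]
    refine ⟨d₂ σ, b₂ σ, rfl, Eq.trans ?_ (hd₁σ σ hσ)⟩
    rw [stdSide_mk, stdSide_mk]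
    rcases hends₂ σ hσ with ⟨h1, h2⟩ | ⟨h1, h2⟩
    · rw [h1, h2]
    · rw [h1, h2, Sym2.eq_swap]
  have hinc : ∀ σ ∈ S, ∀ e : G.edgeSet, σ ∈ emb.tileSides e → e = e₁ σ ∨ e = e₂ σ := by
    intro σ hσ e he
    obtain ⟨d₃, b₃, hde, hsd⟩ := (mem_tileSides_iff hiso e σ).1 he
    -- the midpoint of `σ` lies in the rhombus of `e`
    have hmid : (emb.z (d₁ σ).fst + emb.c (emb.dartFace (d₁ σ) (b₁ σ))) / 2 ∈ emb.rhombus e := by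
      rw [← midpoint_eq_of_sym2_eq (hsd.trans (hd₁σ σ hσ).symm),
        show e = ⟨d₃.edge, d₃.edge_mem⟩ from Subtype.ext hde.symm]
      exact segment_subset_rhombus hiso d₃ b₃
        (openSegment_subset_segment ℝ _ _ (midpoint_mem_openSegment _ _))
    obtain ⟨δ, hδ, hcov⟩ := ball_subset_union_of_across hiso (d₁ σ) (b₁ σ)
      (midpoint_mem_openSegment _ _) (d₂ σ) (b₂ σ) (hends₂ σ hσ) (hfar₂ σ hσ)
    exact edge_eq_or_eq_of_mem_rhombus hiso hrh hδ hcov hmid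
  -- Step 1: the length as a sum of side counts
  set M : Multiset (Sym2 ℂ) :=
    (((pieces a L).map fun p => s(p.1, p.2) : List (Sym2 ℂ)) : Multiset (Sym2 ℂ)) with hM
  have hcard : Multiset.card M = L.length := by simp [hM]
  have hMS : M.toFinset ⊆ S := by
    intro σ hσ
    rw [Multiset.mem_toFinset, hM, Multiset.mem_coe, List.mem_map] at hσ
    obtain ⟨p, hp, rfl⟩ := hσ
    obtain ⟨d, b, hs⟩ := hch p hp
    rw [hmemS]
    refine ⟨d, b, ?_, hs.symm⟩
    rw [hmemT₀]
    refine ⟨p.1, ?_, hR₀ _ (mem_of_mem_pieces hp).1⟩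
    have : p.1 ∈ segment ℝ p.1 p.2 := left_mem_segment ℝ _ _
    rw [segment_eq_of_sym2_eq hs] at this
    exact segment_subset_rhombus hiso d b this
  have hlen : (L.length : ZMod 2) = ∑ σ ∈ S, (M.count σ : ZMod 2) := by
    rw [← hcard, ← Multiset.toFinset_sum_count_eq M, Nat.cast_sum]
    apply Finset.sum_subset hMS
    intro σ _ hσ
    rw [Multiset.mem_toFinset] at hσ
    rw [Multiset.count_eq_zero_of_notMem hσ, Nat.cast_zero]
  -- Step 2: the parity identity at each side
  have hside : ∀ σ ∈ S, (M.count σ : ZMod 2) = (wnd (e₁ σ) : ZMod 2) + (wnd (e₂ σ) : ZMod 2) := by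
    intro σ hσ
    obtain ⟨-, -, -, hAP, -⟩ := dart_quad' hiso (d₁ σ) (b₁ σ)
    have hAPne : emb.z (d₁ σ).fst ≠ emb.c (emb.dartFace (d₁ σ) (b₁ σ)) := by
      intro h; rw [h, sub_self, norm_zero] at hAP; exact zero_ne_one hAP
    have hcount : M.count σ = (pieces a L).count (emb.z (d₁ σ).fst, emb.c (emb.dartFace (d₁ σ) (b₁ σ))) +
        (pieces a L).count (emb.c (emb.dartFace (d₁ σ) (b₁ σ)), emb.z (d₁ σ).fst) := by
      rw [hM, Multiset.coe_count]
      conv_lhs => rw [← hd₁σ σ hσ, stdSide_mk]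
      exact count_map_sym2 hAPne _
    rw [hcount]
    have h := count_add_count_zmod_two hiso hrh hcl hch (d₁ σ) (b₁ σ) (hends₂ σ hσ) (hfar₂ σ hσ)
    rw [h]
    simp only [hwnd, he₁, he₂, tileCentre_dart, hγ]
  -- Step 3: double counting
  have hpair : ∀ σ ∈ S, (wnd (e₁ σ) : ZMod 2) + (wnd (e₂ σ) : ZMod 2) =
      ∑ e ∈ T₁, if σ ∈ emb.tileSides e then (wnd e : ZMod 2) else 0 := by
    intro σ hσ
    rw [← Finset.sum_filter]
    have hfilt : T₁.filter (fun e => σ ∈ emb.tileSides e) = {e₁ σ, e₂ σ} := by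
      ext e
      simp only [Finset.mem_filter, Finset.mem_insert, Finset.mem_singleton]
      constructor
      · rintro ⟨-, he⟩; exact hinc σ hσ e he
      · rintro (rfl | rfl)
        · exact ⟨hT₀₁ (he₁T σ hσ), hσ₁ σ hσ⟩
        · exact ⟨he₂T σ hσ, hσ₂ σ hσ⟩
    rw [hfilt, Finset.sum_pair (hne₁₂ σ hσ)]
  have htile : ∀ e ∈ T₁, (∑ σ ∈ S, if σ ∈ emb.tileSides e then (wnd e : ZMod 2) else 0) = 0 := by
    intro e _
    rw [← Finset.sum_filter, Finset.sum_const, nsmul_eq_mul]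
    by_cases he : e ∈ T₀
    · have : S.filter (fun σ => σ ∈ emb.tileSides e) = emb.tileSides e := by
        ext σ
        simp only [Finset.mem_filter]
        exact ⟨fun h => h.2, fun h => ⟨hSides_sub e he h, h⟩⟩
      rw [this, card_tileSides hiso e]
      have h4 : ((4 : ℕ) : ZMod 2) = 0 := rfl
      rw [h4, zero_mul]
    · rw [hwnd0 e he, Int.cast_zero, mul_zero]
  have htotal : (L.length : ZMod 2) = 0 := by
    rw [hlen, Finset.sum_congr rfl hside, Finset.sum_congr rfl hpair, Finset.sum_comm]
    exact Finset.sum_eq_zero htile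
  exact (ZMod.natCast_eq_zero_iff_even).1 htotal

end SideLoops

/-! ### §8 Corner consistency -/

section Consistency

open RhombicPlanarity

variable {V F : Type*} {G : SimpleGraph V} {emb : RhombicEmbedding G F} {ε : ℝ}

/-- The side-chain of a walk of `G`: each edge `x → x'` contributes the two sides
`z x → c (leftFace) → z x'` of its rhombus. [folklore] -/
def walkChain (emb : RhombicEmbedding G F) : {x y : V} → G.Walk x y → List ℂ
  | _, _, SimpleGraph.Walk.nil => []
  | _, _, SimpleGraph.Walk.cons (v := x') h W =>
      emb.c (emb.leftFace ⟨(_, x'), h⟩) :: emb.z x' :: walkChain emb W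

/-- The side-chain of a walk ends at the position of its last vertex. [folklore] -/
theorem chainEnd_walkChain {x y : V} (W : G.Walk x y) :
    chainEnd (emb.z x) (walkChain emb W) = emb.z y := by
  induction W with
  | nil => rfl
  | cons h W ih => exact ih

/-- The side-chain of a walk has two points per edge. [folklore] -/
theorem length_walkChain {x y : V} (W : G.Walk x y) :
    (walkChain emb W).length = 2 * W.length := by
  induction W with
  | nil => rfl
  | cons h W ih =>
    simp only [walkChain, List.length_cons, SimpleGraph.Walk.length_cons, ih]; ring

/-- The pieces of the side-chain of a walk are sides of the tiling. [folklore] -/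
theorem isSide_of_mem_pieces_walkChain (hiso : emb.IsIsoradial) {x y : V} (W : G.Walk x y) :
    ∀ p ∈ pieces (emb.z x) (walkChain emb W), emb.IsSide p.1 p.2 := by
  induction W with
  | nil => simp [walkChain]
  | cons h W ih =>
    rename_i x x' y
    intro p hp
    simp only [walkChain, pieces_cons, List.mem_cons] at hp
    rcases hp with rfl | rfl | hp
    · exact ⟨⟨(x, x'), h⟩, true, rfl⟩
    · refine ⟨(⟨(x, x'), h⟩ : G.Dart).symm, false, ?_⟩
      rw [dartFace_symm hiso]
      simp [Sym2.eq_swap]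
    · exact ih p hp

/-- **Corner consistency.** In a preconnected isoradial rhombic tiling with bounded angles and
no T-junctions, no vertex position of `G` is a face-centre position: `z v ≠ c (leftFace d)`
(Grimmett–Manolescu 2014, §4.1: the vertices of `G` and of `G*` are the two colour classes of
the bipartite rhombic tiling `G^◇`). A coincidence `z v = c (leftFace d)` would close the
side-chain of a walk `d.fst → ⋯ → v` (two sides per edge) by the single side
`[c (leftFace d), z d.fst]` into a side-loop of odd length, against `even_length_of_isSideLoop`.
[cite: GrimmettManolescu2014Isoradial, §4.1 (G and G* read off the bipartite diamond graph)] -/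
theorem z_ne_c_of_noTJunction (hiso : emb.IsIsoradial) (hrh : emb.IsRhombicTiling)
    (hbap : emb.HasBoundedAngles ε) (hε : 0 < ε) (hT : emb.NoTJunction)
    (hconn : G.Preconnected) (v : V) (d : G.Dart) : emb.z v ≠ emb.c (emb.leftFace d) := by
  intro heq
  have hnb : ∀ w : V, ∃ u, G.Adj w u := fun w =>
    IsoradialCriticality.exists_adj_of_preconnected hconn d.adj w
  obtain ⟨W⟩ := hconn d.fst v
  set l : List ℂ := walkChain emb W ++ [emb.z d.fst] with hl
  have hcl : chainEnd (emb.z d.fst) l = emb.z d.fst := by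
    rw [hl, chainEnd_append, chainEnd_walkChain]; rfl
  have hch : ∀ p ∈ pieces (emb.z d.fst) l, emb.IsSide p.1 p.2 := by
    intro p hp
    rw [hl, pieces_append, List.mem_append, chainEnd_walkChain] at hp
    rcases hp with hp | hp
    · exact isSide_of_mem_pieces_walkChain hiso W p hp
    · simp only [pieces_cons, pieces_nil, List.mem_singleton] at hp
      subst hp
      refine ⟨d, true, ?_⟩
      simp only [dartFace_true]
      rw [heq, Sym2.eq_swap]
  have heven := even_length_of_isSideLoop hiso hrh hbap hε hnb hT hcl hch
  rw [hl, List.length_append, length_walkChain, List.length_singleton] at heven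
  exact Nat.not_even_two_mul_add_one W.length heven

end Consistency

end Literature.Probability.Percolation

end
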